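import Literature.Analysis.FunctionSpaces.TorusRieszTransform
import Literature.Analysis.FunctionSpaces.TorusInverseLaplacian
import Literature.Analysis.FunctionSpaces.TorusApproximateIdentity
import Literature.Analysis.FunctionSpaces.TorusMollifier
import Literature.Analysis.FunctionSpaces.TorusEnstrophyOrthogonality
import Literature.Analysis.FunctionSpaces.TorusTestFunction
import HarnessLib

/-!
# The pressure Poisson problem `Δp = -∂ᵢ∂ⱼGᵢⱼ` on the flat torus for `L^p` tensors

Analysis/FluidPDE support file on the decomposition path of the named fact
`Torus.exists_pressure_of_tendsto_L3` (`FluidPDE/DuchonRobertInviscidLimit`; the pressure of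
`L³` weak solutions of Navier–Stokes/Euler on `T^d`, Duchon–Robert 2000, proof of Prop. 1;
Robinson–Rodrigo–Sadowski 2016, Lemma 5.1 and Prop. 5.3), itself hypothesis (A1) of the assembly
of `Torus.IsDissipationMeasureOf.hasDuchonRobertDefect` (Duchon–Robert 2000, Prop. 4).

Given a tensor field `G = (Gᵢⱼ(a, x))` on a parameter space times the torus, `α × T^d`, with
`Gᵢⱼ ∈ L^p(α × T^d)` (in the fluid application `a = t ∈ (0, T)`, `Gᵢⱼ = uᵢuⱼ`, `p = 3/2`), this
file constructs the **pressure** `P = -∑ᵢⱼ RᵢRⱼ Gᵢⱼ` slice-wise and proves, modulo the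
Calderón–Zygmund bound `‖∂ⱼ∂ₖw‖_p ≤ C‖Δw‖_p` on `T^d` (the named fact
`Torus.eLpNorm_hessian_le_laplacian` of `FunctionSpaces/TorusRieszTransform`, Robinson–Rodrigo–Sadowski
2016, Thm. B.7, consumed here as the hypothesis `Torus.HessianBound d p C`):

* `Torus.exists_pressure` — there is a jointly measurable `P : α → T^d → ℝ` with
  `∫⁻ |P|^r ≤ K ∑ᵢⱼ ∫⁻ |Gᵢⱼ|^r` (`r = p.toReal`, `K = Torus.presConst d p C`), which is the
  `L^p(α × T^d)` limit of the approximate pressures `pₙ = p_{ρₙ}[G]` below, and whose slices solve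
  the pressure Poisson equation very weakly for a.e. `a`:
  `∫ P(a) Δφ = -∑ᵢⱼ ∫ Gᵢⱼ(a) ∂ᵢ∂ⱼφ` for every `φ ∈ C^∞(T^d)` (Robinson–Rodrigo–Sadowski 2016,
  Lemma 5.1 with (5.7)/(5.10) `‖p‖_{L^r} ≤ C∑ᵢⱼ‖uᵢuⱼ‖_{L^r}`, and "`⟨-Δp, ψ(t)⟩ = ⟨∂ᵢ∂ⱼ(uᵢuⱼ), ψ(t)⟩`
  for almost every `t`" in the proof of Prop. 5.3);
* `Torus.lintegral_prod_rpow_pressure_sub_le` — **continuity in the data**: two such limits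
  `P`, `P'` for data `G`, `G'` satisfy `∫⁻ |P - P'|^r ≤ K ∑ᵢⱼ ∫⁻ |Gᵢⱼ - G'ᵢⱼ|^r` (Duchon–Robert
  2000, proof of Prop. 1: "the linear operator `uᵢuₖ → p` is strongly continuous on `L^q` for
  `1 < q < ∞`, and so `p ∈ L^{3/2}(0,T; L^{3/2})`").

## Construction

For a smooth kernel `ρ` put `κᵢⱼ[ρ] := -∂ᵢ∂ⱼΔ⁻¹ρ` (`Torus.presKernel`; `Δ⁻¹` is the tree's
`Torus.invLaplacian`, `Δ Δ⁻¹ h = h - ∫h`) and, for a tensor slice `g = (gᵢⱼ)`, `gᵢⱼ ∈ L¹(T^d)`,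

  `p_ρ[g] := ∑ᵢⱼ gᵢⱼ ⋆ κᵢⱼ[ρ] = -∑ᵢⱼ ∂ᵢ∂ⱼ(gᵢⱼ ⋆ Δ⁻¹ρ)`     (`Torus.presApproxSlice`),

a convolution with smooth kernels, hence jointly measurable in a parameter
(`Torus.aestronglyMeasurable_uncurry_presApprox`). Slice facts (all proved):

* `Torus.integral_presApproxSlice_mul_laplacian`: `∫ p_ρ[g] Δφ = -∑ᵢⱼ ∫ (gᵢⱼ ⋆ ρ) ∂ᵢ∂ⱼφ` — with
  `V = gᵢⱼ ⋆ Δ⁻¹ρ`, `∫ (∂ᵢ∂ⱼV)Δφ = ∫ (ΔV) ∂ᵢ∂ⱼφ` (two integrations by parts, Schwarz, Green) and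
  `ΔV = gᵢⱼ ⋆ ρ - (∫ρ)(∫gᵢⱼ)`;
* `Torus.lintegral_rpow_presApproxSlice_sub_le`: for kernels of equal mass,
  `p_{ρ₁}[g] - p_{ρ₂}[g] = -∑ᵢⱼ ∂ᵢ∂ⱼW`, `W = gᵢⱼ ⋆ (Δ⁻¹ρ₁ - Δ⁻¹ρ₂)`, `ΔW = gᵢⱼ ⋆ ρ₁ - gᵢⱼ ⋆ ρ₂`,
  so the Calderón–Zygmund hypothesis gives
  `∫⁻|p_{ρ₁}[g] - p_{ρ₂}[g]|^r ≤ (n²)^{r-1}C^r ∑ᵢⱼ ∫⁻ |gᵢⱼ ⋆ ρ₁ - gᵢⱼ ⋆ ρ₂|^r`;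
* `Torus.lintegral_rpow_presApproxSlice_le`: `∫⁻|p_ρ[g]|^r ≤ K ∑ᵢⱼ ∫⁻|gᵢⱼ|^r` (unit mass, Young
  and Jensen for the constant `∫gᵢⱼ`).

With the canonical mollifiers `ρₙ = Torus.kernel (1/(n+4))` (`Torus.presMollifier`) and Tonelli,
the mollified data `Gᵢⱼ ⋆ ρₙ` converge in `L^p(α × T^d)` (the tree's
`Torus.tendsto_lintegral_prod_rpow_enorm_convolution_sub_self`), so `(pₙ)` is Cauchy in
`L^p(α × T^d)` and has a limit `P` (completeness of `Lp`, `exists_memLp_tendsto_of_tendsto_eLpNorm_sub`);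
along an a.e.-convergent subsequence of slices the weak equation passes to the limit, the slices
of the data converging by the slice approximate identity
(`Torus.tendsto_eLpNorm_convolution_sub_self_of_eventually`). The approximate pressures are
linear in the data, whence the continuity estimate for the limits.

No uniqueness / normalisation of the pressure is asserted or needed (the consumer only uses
existence, the bound, the weak equation and the continuity estimate); `d` is assumed nonempty
where `Δ Δ⁻¹` is used.

## Mathlib / tree search

Mathlib (this pin): completeness of `Lp` (`cauchySeq_tendsto_of_complete`,
`Lp.cauchySeq_Lp_iff_cauchySeq_eLpNorm`, `Lp.tendsto_Lp_iff_tendsto_eLpNorm'`), Tonelli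
(`lintegral_prod`, `AEMeasurable.lintegral_prod_right'`), `ENNReal.rpow_sum_le_const_mul_sum_rpow`,
`eLpNorm_le_eLpNorm_of_exponent_le`; no pressure/Riesz-transform operators. Tree: everything on
the torus side is reused — `TorusInverseLaplacian` (`Δ⁻¹`, `laplacian_invLaplacian`),
`TorusConvolution` (`partialDeriv_convolution`, `laplacian_convolution`, Young, parametrised
measurability), `TorusApproximateIdentity` (slice and product approximate identities),
`TorusMollifier` (`Torus.kernel`), `TorusCalculusProofs` (integration by parts),
`TorusEnstrophyOrthogonality` (`partialDeriv_comm`). The whole-space analogue of the CZ input is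
`Literature.Analysis.FluidPDE.stein1970_hessian_Lp_bound` (`FluidPDE/HessianLaplacianLp`).

## References

* J. C. Robinson, J. L. Rodrigo, W. Sadowski, *The Three-Dimensional Navier–Stokes Equations:
  Classical Theory*, CUP 2016: §5.1, Lemma 5.1, (5.3)–(5.10) (book p. 88); §5.2, Prop. 5.3 and
  its proof (pp. 89–90); App. B, Thm. B.7 (pp. 385–386). [RobinsonRodrigoSadowskiCUP2016]
* J. Duchon, R. Robert, *Inertial energy dissipation for weak solutions of incompressible Euler
  and Navier–Stokes equations*, Nonlinearity 13 (2000) 249–255, proof of Prop. 1 (pp. 250–251).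
  [DuchonRobert2000]
* L. C. Evans, *Partial Differential Equations*, 2nd ed. (AMS 2010), App. C.2 Thm. 1–3
  (integration by parts), App. C.4 Thm. 7 (mollifiers). [Evans2010]
-/

noncomputable section

open MeasureTheory Set Filter Topology Function UnitAddTorus
open scoped ENNReal NNReal Convolution ContDiff

namespace Literature.Analysis.FluidPDE.Torus

open Literature.Analysis.FunctionSpaces Literature.Analysis.FunctionSpaces.Torus

variable {d : Type*} [Fintype d] [DecidableEq d]

/-! ## Calculus complements on `T^d` -/

section Calculus

variable {F : Type*} [NormedAddCommGroup F] [NormedSpace ℝ F]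

/-- `∂ᵢ(f - g) = ∂ᵢf - ∂ᵢg` pointwise, for `C¹` functions on the torus (private copy of the
tree's `Torus.partialDeriv_sub_at` of `FluidPDE/Antidivergence`, not imported here to keep this
file's imports inside `FunctionSpaces`). [folklore] -/
private theorem partialDeriv_fun_sub_apply {f g : UnitAddTorus d → F} (hf : IsContDiff 1 f) (hg : IsContDiff 1 g)
    (i : d) (x : UnitAddTorus d) :
    partialDeriv i (fun y => f y - g y) x = partialDeriv i f x - partialDeriv i g x := by
  have h : (fun y => f y - g y) = f + fun y => -g y := by funext y; simp [sub_eq_add_neg]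
  have hg' : IsContDiff 1 (fun y => -g y) := ContDiff.neg hg
  rw [h, partialDeriv_add hf hg', Pi.add_apply, partialDeriv_neg, sub_eq_add_neg]

/-- `Δ(f - g) = Δf - Δg` pointwise, for smooth functions on the torus. [folklore] -/
theorem laplacian_fun_sub_apply {f g : UnitAddTorus d → F} (hf : IsSmooth f) (hg : IsSmooth g)
    (x : UnitAddTorus d) :
    laplacian (fun y => f y - g y) x = laplacian f x - laplacian g x := by
  have hfg : IsSmooth (fun y => f y - g y) := hf.sub hg
  rw [laplacian_eq_sum_partialDeriv_partialDeriv hfg, laplacian_eq_sum_partialDeriv_partialDeriv hf,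
    laplacian_eq_sum_partialDeriv_partialDeriv hg, ← Finset.sum_sub_distrib]
  refine Finset.sum_congr rfl fun i _ => ?_
  have h1 : partialDeriv i (fun y => f y - g y) = fun y => partialDeriv i f y - partialDeriv i g y :=
    funext (partialDeriv_fun_sub_apply (hf.isContDiff (by simp)) (hg.isContDiff (by simp)) i)
  rw [h1, partialDeriv_fun_sub_apply ((hf.partialDeriv i).isContDiff (by simp))
    ((hg.partialDeriv i).isContDiff (by simp))]

/-- The Laplacian kills constants added to a smooth function: `Δ(f - c) = Δf`. [folklore] -/
theorem laplacian_sub_const_apply {f : UnitAddTorus d → F} (hf : IsSmooth f) (c : F) (x : UnitAddTorus d) :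
    laplacian (fun y => f y - c) x = laplacian f x := by
  have hc : IsSmooth (fun _ : UnitAddTorus d => c) := contDiff_const
  rw [laplacian_fun_sub_apply hf hc, laplacian_eq_sum_partialDeriv_partialDeriv hc]
  simp [partialDeriv, Torus.lineDeriv]

/-- **Third derivatives commute with the Laplacian**: `∂ₖ(Δφ) = Δ(∂ₖφ)` for smooth `φ` on `T^d`
(`Δ = ∑ᵢ∂ᵢ∂ᵢ` and Schwarz, `Torus.partialDeriv_comm`). [folklore] -/
theorem partialDeriv_laplacian {φ : UnitAddTorus d → F} (hφ : IsSmooth φ) (k : d) (x : UnitAddTorus d) :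
    partialDeriv k (laplacian φ) x = laplacian (partialDeriv k φ) x := by
  have hL : laplacian φ = fun y => ∑ i, partialDeriv i (partialDeriv i φ) y :=
    funext (laplacian_eq_sum_partialDeriv_partialDeriv hφ)
  rw [hL, partialDeriv_finset_sum _ (fun i _ => ((hφ.partialDeriv i).partialDeriv i).isContDiff (by simp)),
    laplacian_eq_sum_partialDeriv_partialDeriv (hφ.partialDeriv k)]
  refine Finset.sum_congr rfl fun i _ => ?_
  -- `∂ₖ∂ᵢ∂ᵢφ = ∂ᵢ∂ₖ∂ᵢφ = ∂ᵢ∂ᵢ∂ₖφ`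
  rw [partialDeriv_comm (hφ.partialDeriv i) k i x]
  have h2 : partialDeriv k (partialDeriv i φ) = partialDeriv i (partialDeriv k φ) :=
    funext (partialDeriv_comm hφ k i)
  rw [h2]

/-- **Integration by parts for one partial derivative** on the torus (no boundary):
`∫ (∂ᵢa) b = -∫ a (∂ᵢb)` for smooth real `a`, `b` (Evans, App. C.2, Thm. 2). [folklore] -/
theorem integral_partialDeriv_mul_eq_neg_integral {a b : UnitAddTorus d → ℝ} (ha : IsSmooth a) (hb : IsSmooth b)
    (i : d) : ∫ x, partialDeriv i a x * b x = -∫ x, a x * partialDeriv i b x := by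
  have hab : IsSmooth (fun y => a y * b y) := ha.mul hb
  have h1 : IsSmooth (fun y => a y * partialDeriv i b y) := ha.mul (hb.partialDeriv i)
  have h2 : IsSmooth (fun y => partialDeriv i a y * b y) := (ha.partialDeriv i).mul hb
  have h0 : ∫ x, partialDeriv i (fun y => a y * b y) x = 0 := integral_partialDeriv_eq_zero_holds hab i
  simp_rw [partialDeriv_mul (ha.isContDiff (by simp)) (hb.isContDiff (by simp))] at h0
  rw [integral_add h1.integrable h2.integrable] at h0
  linarith

/-- **Moving a Hessian across the Laplacian**: `∫ (∂ᵢ∂ⱼV) Δφ = ∫ (ΔV) ∂ᵢ∂ⱼφ` for smooth real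
`V`, `φ` on `T^d` (two integrations by parts, Schwarz, and Green's second identity). [folklore] -/
theorem integral_hessian_mul_laplacian {V φ : UnitAddTorus d → ℝ} (hV : IsSmooth V) (hφ : IsSmooth φ)
    (i j : d) :
    ∫ x, partialDeriv i (partialDeriv j V) x * laplacian φ x =
      ∫ x, laplacian V x * partialDeriv i (partialDeriv j φ) x := by
  rw [integral_partialDeriv_mul_eq_neg_integral (hV.partialDeriv j) hφ.laplacian i,
    integral_partialDeriv_mul_eq_neg_integral hV (hφ.laplacian.partialDeriv i) j, neg_neg]
  have h3 : (fun x => partialDeriv j (partialDeriv i (laplacian φ)) x) =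
      fun x => laplacian (partialDeriv j (partialDeriv i φ)) x := by
    funext x
    have e1 : partialDeriv i (laplacian φ) = laplacian (partialDeriv i φ) :=
      funext (partialDeriv_laplacian hφ i)
    rw [e1, partialDeriv_laplacian (hφ.partialDeriv i) j]
  simp_rw [show ∀ x, partialDeriv j (partialDeriv i (laplacian φ)) x =
      laplacian (partialDeriv j (partialDeriv i φ)) x from fun x => congrFun h3 x]
  rw [integral_mul_laplacian_comm_holds hV ((hφ.partialDeriv i).partialDeriv j)]
  have e2 : (fun x => laplacian V x * partialDeriv j (partialDeriv i φ) x) =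
      fun x => laplacian V x * partialDeriv i (partialDeriv j φ) x := by
    funext x; rw [partialDeriv_comm hφ j i x]
  rw [e2]

end Calculus

/-! ## Convolution complements on `T^d` -/

section Convolution

omit [DecidableEq d] in
/-- Convolution with a negated kernel: `θ ⋆ (-k) = -(θ ⋆ k)` pointwise. [folklore] -/
theorem convolution_neg_right_apply (θ k : UnitAddTorus d → ℝ) (x : UnitAddTorus d) :
    (θ ⋆ fun y => -k y) x = -(θ ⋆ k) x := by
  simp only [convolution_lsmul, smul_eq_mul, mul_neg, integral_neg]

omit [DecidableEq d] in
/-- Convolution is subtractive in the (continuous) kernel: `θ ⋆ (k₁ - k₂) = θ ⋆ k₁ - θ ⋆ k₂`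
pointwise, for `θ ∈ L¹`. [folklore] -/
theorem convolution_sub_right_apply {θ : UnitAddTorus d → ℝ} (hθ : Integrable θ volume)
    {k₁ k₂ : UnitAddTorus d → ℝ} (hk₁ : Continuous k₁) (hk₂ : Continuous k₂) (x : UnitAddTorus d) :
    (θ ⋆ fun y => k₁ y - k₂ y) x = (θ ⋆ k₁) x - (θ ⋆ k₂) x := by
  simp only [convolution_lsmul, smul_eq_mul, mul_sub]
  exact integral_sub (integrable_smul_comp_sub hθ hk₁ x) (integrable_smul_comp_sub hθ hk₂ x)

omit [DecidableEq d] in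
/-- Convolution is subtractive in the (integrable) function, pointwise: `(θ₁ - θ₂) ⋆ k =
θ₁ ⋆ k - θ₂ ⋆ k` for continuous `k`. [folklore] -/
theorem convolution_sub_left_apply {θ₁ θ₂ : UnitAddTorus d → ℝ} (hθ₁ : Integrable θ₁ volume)
    (hθ₂ : Integrable θ₂ volume) {k : UnitAddTorus d → ℝ} (hk : Continuous k) (x : UnitAddTorus d) :
    ((θ₁ - θ₂) ⋆ k) x = (θ₁ ⋆ k) x - (θ₂ ⋆ k) x := by
  rw [sub_convolution hθ₁ hθ₂ hk]
  rfl

omit [DecidableEq d] in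
/-- Convolution with a constant: `(θ ⋆ c)(x) = c ∫ θ`. [folklore] -/
theorem convolution_const_right_apply (θ : UnitAddTorus d → ℝ) (c : ℝ) (x : UnitAddTorus d) :
    (θ ⋆ fun _ => c) x = c * ∫ y, θ y := by
  simp only [convolution_lsmul, smul_eq_mul]
  rw [integral_mul_const, mul_comm]

/-- `∂ᵢ∂ⱼ(θ ⋆ k) = θ ⋆ ∂ᵢ∂ⱼk` for `θ ∈ L¹` and smooth `k`. [folklore] -/
theorem partialDeriv_partialDeriv_convolution {θ : UnitAddTorus d → ℝ} (hθ : Integrable θ volume)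
    {k : UnitAddTorus d → ℝ} (hk : IsSmooth k) (i j : d) (x : UnitAddTorus d) :
    partialDeriv i (partialDeriv j (θ ⋆ k)) x = (θ ⋆ partialDeriv i (partialDeriv j k)) x := by
  have h1 : partialDeriv j (θ ⋆ k) = θ ⋆ partialDeriv j k := funext (partialDeriv_convolution hθ hk j)
  rw [h1, partialDeriv_convolution hθ (hk.partialDeriv j) i]

end Convolution

/-! ## The approximate pressure of a tensor slice -/

section Slice

/-- **The pressure kernels** attached to a smooth even mollifier `ρ` on `T^d`:
`κᵢⱼ[ρ] := -∂ᵢ∂ⱼ Δ⁻¹ρ`, so that `g ⋆ κᵢⱼ[ρ] = -∂ᵢ∂ⱼ Δ⁻¹(g ⋆ ρ)` is (minus) the double Riesz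
transform `-RᵢRⱼ` of the mollified datum `g ⋆ ρ` (Robinson–Rodrigo–Sadowski 2016, (5.4), (5.9):
`p = ∂ᵢ∂ⱼ(-Δ)⁻¹(uᵢuⱼ)`). [folklore] -/
def presKernel (ρ : UnitAddTorus d → ℝ) (i j : d) : UnitAddTorus d → ℝ :=
  fun x => -partialDeriv i (partialDeriv j (invLaplacian ρ)) x

/-- **The approximate pressure of a tensor slice** `g = (gᵢⱼ)`, `gᵢⱼ ∈ L¹(T^d)`:
`p_ρ[g] := ∑ᵢⱼ gᵢⱼ ⋆ κᵢⱼ[ρ] = -∑ᵢⱼ ∂ᵢ∂ⱼΔ⁻¹(gᵢⱼ ⋆ ρ)`, the solution of the pressure Poisson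
equation `Δp = -∂ᵢ∂ⱼ(gᵢⱼ ⋆ ρ)` with mollified data (Robinson–Rodrigo–Sadowski 2016, Lemma 5.1,
(5.6)/(5.9)). Written as a convolution with the smooth kernels `κᵢⱼ[ρ]` so that joint
measurability in a time parameter is automatic. [folklore] -/
def presApproxSlice (ρ : UnitAddTorus d → ℝ) (g : d → d → UnitAddTorus d → ℝ) (x : UnitAddTorus d) : ℝ :=
  ∑ i, ∑ j, (g i j ⋆ presKernel ρ i j) x

variable {ρ : UnitAddTorus d → ℝ}

/-- The pressure kernels of a smooth mollifier are smooth. [folklore] -/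
theorem isSmooth_presKernel (hρ : IsSmooth ρ) (i j : d) : IsSmooth (presKernel ρ i j) :=
  (((isSmooth_invLaplacian hρ).partialDeriv j).partialDeriv i).neg

/-- The pressure kernels of a smooth mollifier are continuous. [folklore] -/
theorem continuous_presKernel (hρ : IsSmooth ρ) (i j : d) : Continuous (presKernel ρ i j) :=
  (isSmooth_presKernel hρ i j).continuous

/-- **Derivative form of the approximate pressure**: for integrable data,
`p_ρ[g] = -∑ᵢⱼ ∂ᵢ∂ⱼ(gᵢⱼ ⋆ Δ⁻¹ρ)` (derivatives of a mollification fall on the smooth kernel,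
Evans, App. C.4, Thm. 7 (i)). [folklore] -/
theorem presApproxSlice_eq_neg_sum (hρ : IsSmooth ρ) {g : d → d → UnitAddTorus d → ℝ}
    (hg : ∀ i j, Integrable (g i j) volume) (x : UnitAddTorus d) :
    presApproxSlice ρ g x = -∑ i, ∑ j, partialDeriv i (partialDeriv j (g i j ⋆ invLaplacian ρ)) x := by
  have h : ∀ i j, (g i j ⋆ presKernel ρ i j) x =
      -partialDeriv i (partialDeriv j (g i j ⋆ invLaplacian ρ)) x := by
    intro i j
    rw [show presKernel ρ i j = fun y => -partialDeriv i (partialDeriv j (invLaplacian ρ)) y from rfl,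
      convolution_neg_right_apply, partialDeriv_partialDeriv_convolution (hg i j) (isSmooth_invLaplacian hρ)]
  simp only [presApproxSlice, h, Finset.sum_neg_distrib]

/-- The convolution terms of the approximate pressure are continuous. [folklore] -/
theorem continuous_convolution_presKernel (hρ : IsSmooth ρ) {θ : UnitAddTorus d → ℝ}
    (hθ : Integrable θ volume) (i j : d) : Continuous (θ ⋆ presKernel ρ i j) :=
  continuous_convolution hθ (continuous_presKernel hρ i j)

/-- The approximate pressure of integrable data is continuous. [folklore] -/
theorem continuous_presApproxSlice (hρ : IsSmooth ρ) {g : d → d → UnitAddTorus d → ℝ}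
    (hg : ∀ i j, Integrable (g i j) volume) : Continuous (presApproxSlice ρ g) := by
  unfold presApproxSlice
  exact continuous_finsetSum _ fun i _ => continuous_finsetSum _ fun j _ =>
    continuous_convolution_presKernel hρ (hg i j) i j

/-- **The approximate pressure solves the mollified pressure Poisson equation weakly**:
for integrable data `gᵢⱼ`, a smooth mollifier `ρ` and every smooth test function `φ`,
`∫ p_ρ[g] Δφ = -∑ᵢⱼ ∫ (gᵢⱼ ⋆ ρ) ∂ᵢ∂ⱼφ` (`d` nonempty). Proof: with `V = gᵢⱼ ⋆ Δ⁻¹ρ`,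
`∫ (∂ᵢ∂ⱼV) Δφ = ∫ (ΔV) ∂ᵢ∂ⱼφ` (`integral_hessian_mul_laplacian`) and
`ΔV = gᵢⱼ ⋆ ΔΔ⁻¹ρ = gᵢⱼ ⋆ ρ - (∫ρ)(∫gᵢⱼ)`, the constant integrating to zero against `∂ᵢ∂ⱼφ`
(Robinson–Rodrigo–Sadowski 2016, proof of Prop. 5.3: `⟨-Δp, ψ⟩ = ⟨∂ᵢ∂ⱼ(uᵢuⱼ), ψ⟩`). [cite: RobinsonRodrigoSadowskiCUP2016, Prop. 5.3 (p. 90)] -/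
theorem integral_presApproxSlice_mul_laplacian [Nonempty d] (hρ : IsSmooth ρ)
    {g : d → d → UnitAddTorus d → ℝ} (hg : ∀ i j, Integrable (g i j) volume)
    {φ : UnitAddTorus d → ℝ} (hφ : IsSmooth φ) :
    ∫ x, presApproxSlice ρ g x * laplacian φ x =
      -∑ i, ∑ j, ∫ x, (g i j ⋆ ρ) x * partialDeriv i (partialDeriv j φ) x := by
  have hΔρ : IsSmooth (invLaplacian ρ) := isSmooth_invLaplacian hρ
  -- expand and distribute the integral
  have hpt : ∀ x, presApproxSlice ρ g x * laplacian φ x =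
      ∑ i, ∑ j, -(partialDeriv i (partialDeriv j (g i j ⋆ invLaplacian ρ)) x * laplacian φ x) := by
    intro x
    rw [presApproxSlice_eq_neg_sum hρ hg, neg_mul, Finset.sum_mul, ← Finset.sum_neg_distrib]
    refine Finset.sum_congr rfl fun i _ => ?_
    rw [Finset.sum_mul, ← Finset.sum_neg_distrib]
  have hV : ∀ i j, IsSmooth (g i j ⋆ invLaplacian ρ) := fun i j => isSmooth_convolution (hg i j) hΔρ
  have hint : ∀ i j, Integrable (fun x => -(partialDeriv i (partialDeriv j (g i j ⋆ invLaplacian ρ)) x *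
      laplacian φ x)) volume := fun i j => by
    have hs : IsSmooth (fun x => partialDeriv i (partialDeriv j (g i j ⋆ invLaplacian ρ)) x * laplacian φ x) :=
      (((hV i j).partialDeriv j).partialDeriv i).mul hφ.laplacian
    exact hs.integrable.neg
  simp_rw [hpt]
  rw [integral_finsetSum _ fun i _ => integrable_finsetSum _ fun j _ => hint i j, ← Finset.sum_neg_distrib]
  refine Finset.sum_congr rfl fun i _ => ?_
  rw [integral_finsetSum _ fun j _ => hint i j, ← Finset.sum_neg_distrib]
  refine Finset.sum_congr rfl fun j _ => ?_
  rw [integral_neg, integral_hessian_mul_laplacian (hV i j) hφ]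
  -- `ΔV = g ⋆ ρ - const`
  have hΔV : ∀ x, laplacian (g i j ⋆ invLaplacian ρ) x = (g i j ⋆ ρ) x - (∫ y, ρ y) * ∫ y, g i j y := by
    intro x
    rw [laplacian_convolution (hg i j) hΔρ]
    have e : laplacian (invLaplacian ρ) = fun y => ρ y - ∫ z, ρ z := funext (laplacian_invLaplacian hρ)
    rw [e, convolution_sub_right_apply (hg i j) hρ.continuous continuous_const, convolution_const_right_apply]
  simp_rw [hΔV, sub_mul]
  have hψ : IsSmooth (partialDeriv i (partialDeriv j φ)) := (hφ.partialDeriv j).partialDeriv i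
  have hI1 : Integrable (fun x => (g i j ⋆ ρ) x * partialDeriv i (partialDeriv j φ) x) volume :=
    ((continuous_convolution (hg i j) hρ.continuous).mul hψ.continuous).integrable_unitAddTorus
  have hI2 : Integrable (fun x => ((∫ y, ρ y) * ∫ y, g i j y) * partialDeriv i (partialDeriv j φ) x) volume :=
    (continuous_const.mul hψ.continuous).integrable_unitAddTorus
  rw [integral_sub hI1 hI2, integral_const_mul, integral_partialDeriv_eq_zero_holds (hφ.partialDeriv j) i,
    mul_zero, sub_zero]

end Slice

/-! ## `L^p` tools: from the Calderón–Zygmund hypothesis to `∫⁻ ‖·‖ₑ^r` bounds -/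

section LpTools

variable {α : Type*} [MeasurableSpace α] {μ : Measure α}

omit [Fintype d] [DecidableEq d] in
/-- From `‖f‖_{L^p} ≤ C ‖g‖_{L^p}` to `∫⁻ ‖f‖ₑ^r ≤ C^r ∫⁻ ‖g‖ₑ^r`, `r = p.toReal`, `0 < p < ∞`. [folklore] -/
theorem lintegral_rpow_le_of_eLpNorm_le {E : Type*} [NormedAddCommGroup E] {f g : α → E} {p : ℝ≥0∞}
    (hp0 : p ≠ 0) (hpt : p ≠ ⊤) {C : ℝ≥0∞} (h : eLpNorm f p μ ≤ C * eLpNorm g p μ) :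
    ∫⁻ x, ‖f x‖ₑ ^ p.toReal ∂μ ≤ C ^ p.toReal * ∫⁻ x, ‖g x‖ₑ ^ p.toReal ∂μ := by
  have hr : 0 < p.toReal := ENNReal.toReal_pos hp0 hpt
  rw [eLpNorm_eq_lintegral_rpow_enorm_toReal hp0 hpt, eLpNorm_eq_lintegral_rpow_enorm_toReal hp0 hpt, one_div] at h
  have h2 := ENNReal.rpow_le_rpow h hr.le
  rwa [ENNReal.rpow_inv_rpow hr.ne', ENNReal.mul_rpow_of_nonneg _ _ hr.le,
    ENNReal.rpow_inv_rpow hr.ne'] at h2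

omit [DecidableEq d] in
/-- `(∑ᵢ∑ⱼ aᵢⱼ)^r ≤ (n²)^{r-1} ∑ᵢ∑ⱼ aᵢⱼ^r` for `r ≥ 1`, `n = #d` (convexity of `t ↦ t^r`). [folklore] -/
theorem rpow_sum_sum_le (a : d → d → ℝ≥0∞) {r : ℝ} (hr : 1 ≤ r) :
    (∑ i, ∑ j, a i j) ^ r ≤ ((Fintype.card d : ℝ≥0∞) ^ 2) ^ (r - 1) * ∑ i, ∑ j, a i j ^ r := by
  have h1 := ENNReal.rpow_sum_le_const_mul_sum_rpow Finset.univ (fun i => ∑ j, a i j) hr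
  have h2 : ∀ i, (∑ j, a i j) ^ r ≤ (Fintype.card d : ℝ≥0∞) ^ (r - 1) * ∑ j, a i j ^ r := fun i => by
    have := ENNReal.rpow_sum_le_const_mul_sum_rpow Finset.univ (fun j => a i j) hr
    rwa [Finset.card_univ] at this
  rw [Finset.card_univ] at h1
  calc (∑ i, ∑ j, a i j) ^ r ≤ (Fintype.card d : ℝ≥0∞) ^ (r - 1) * ∑ i, (∑ j, a i j) ^ r := h1
    _ ≤ (Fintype.card d : ℝ≥0∞) ^ (r - 1) * ∑ i, ((Fintype.card d : ℝ≥0∞) ^ (r - 1) * ∑ j, a i j ^ r) := by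
        gcongr with i
        exact h2 i
    _ = ((Fintype.card d : ℝ≥0∞) ^ 2) ^ (r - 1) * ∑ i, ∑ j, a i j ^ r := by
        rw [← Finset.mul_sum, ← mul_assoc, ← ENNReal.mul_rpow_of_nonneg _ _ (by linarith), sq]

omit [DecidableEq d] in
/-- **Jensen on the torus**: `‖∫ g‖ₑ^r ≤ ∫⁻ ‖g‖ₑ^r` for `r ≥ 1` (the torus has total mass one;
`‖∫g‖ ≤ ‖g‖_{L¹} ≤ ‖g‖_{L^r}`). [folklore] -/
theorem enorm_integral_rpow_le_lintegral {g : UnitAddTorus d → ℝ} (hg : AEStronglyMeasurable g volume)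
    {r : ℝ} (hr : 1 ≤ r) : ‖∫ x, g x‖ₑ ^ r ≤ ∫⁻ x, ‖g x‖ₑ ^ r := by
  have hr0 : 0 < r := one_pos.trans_le hr
  set q : ℝ≥0∞ := ENNReal.ofReal r with hq
  have hq1 : (1 : ℝ≥0∞) ≤ q := by rw [hq, ← ENNReal.ofReal_one]; exact ENNReal.ofReal_le_ofReal hr
  have hq0 : q ≠ 0 := (zero_lt_one.trans_le hq1).ne'
  have hqr : q.toReal = r := ENNReal.toReal_ofReal hr0.le
  have h1 : ‖∫ x, g x‖ₑ ≤ eLpNorm g 1 volume := by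
    rw [eLpNorm_one_eq_lintegral_enorm]
    exact enorm_integral_le_lintegral_enorm g
  have h2 : eLpNorm g 1 volume ≤ eLpNorm g q volume := eLpNorm_le_eLpNorm_of_exponent_le hq1 hg
  have h3 : eLpNorm g q volume = (∫⁻ x, ‖g x‖ₑ ^ r) ^ (1 / r) := by
    rw [eLpNorm_eq_lintegral_rpow_enorm_toReal hq0 ENNReal.ofReal_ne_top, hqr]
  have h4 := ENNReal.rpow_le_rpow ((h1.trans h2).trans_eq h3) hr0.le
  rwa [one_div, ENNReal.rpow_inv_rpow hr0.ne'] at h4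

omit [DecidableEq d] in
/-- `∫⁻ ‖a - c‖ₑ^r ≤ 2^{r-1} (∫⁻ ‖a‖ₑ^r + ‖c‖ₑ^r)` on the torus, for a constant `c`, `r ≥ 1`. [folklore] -/
theorem lintegral_rpow_sub_const_le (a : UnitAddTorus d → ℝ) (c : ℝ) {r : ℝ} (hr : 1 ≤ r) :
    ∫⁻ x, ‖a x - c‖ₑ ^ r ≤ (2 : ℝ≥0∞) ^ (r - 1) * ((∫⁻ x, ‖a x‖ₑ ^ r) + ‖c‖ₑ ^ r) := by
  have hpt : ∀ x, ‖a x - c‖ₑ ^ r ≤ (2 : ℝ≥0∞) ^ (r - 1) * (‖a x‖ₑ ^ r + ‖c‖ₑ ^ r) := fun x =>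
    calc ‖a x - c‖ₑ ^ r ≤ (‖a x‖ₑ + ‖c‖ₑ) ^ r := by
          gcongr
          simpa [sub_eq_add_neg] using enorm_add_le (a x) (-c)
      _ ≤ (2 : ℝ≥0∞) ^ (r - 1) * (‖a x‖ₑ ^ r + ‖c‖ₑ ^ r) := ENNReal.rpow_add_le_mul_rpow_add_rpow _ _ hr
  calc ∫⁻ x, ‖a x - c‖ₑ ^ r ≤ ∫⁻ x, (2 : ℝ≥0∞) ^ (r - 1) * (‖a x‖ₑ ^ r + ‖c‖ₑ ^ r) := lintegral_mono hpt
    _ = (2 : ℝ≥0∞) ^ (r - 1) * ((∫⁻ x, ‖a x‖ₑ ^ r) + ‖c‖ₑ ^ r) := by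
        rw [lintegral_const_mul' _ _ (ENNReal.rpow_ne_top_of_nonneg (by linarith) ENNReal.ofNat_ne_top),
          lintegral_add_right' _ aemeasurable_const, lintegral_const, measure_univ, mul_one]

end LpTools

/-! ## Calderón–Zygmund bounds for the approximate pressure of a slice -/

section SliceBounds

/-- The **Calderón–Zygmund hypothesis** in the form consumed below: the content of the named fact
`Torus.eLpNorm_hessian_le_laplacian` (`FunctionSpaces/TorusRieszTransform`; Robinson–Rodrigo–Sadowski
2016, Thm. B.7) at one exponent `p` with one constant `C`, so that
`eLpNorm_hessian_le_laplacian d ↔ ∀ p, 1 < p → p < ⊤ → ∃ C, HessianBound d p C` definitionally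
(`Torus.hessianBound_of_fact`). [cite: RobinsonRodrigoSadowskiCUP2016, App. B Thm. B.7 (pp. 385–386)] -/
def HessianBound (d : Type*) [Fintype d] [DecidableEq d] (p : ℝ≥0∞) (C : ℝ≥0) : Prop :=
  ∀ (w : UnitAddTorus d → ℝ), IsSmooth w → ∀ j k : d,
    eLpNorm (partialDeriv j (partialDeriv k w)) p volume ≤ C * eLpNorm (laplacian w) p volume

variable {p : ℝ≥0∞} {C : ℝ≥0}

/-- The difference of two approximate pressures with kernels `ρ₁`, `ρ₂` is a sum of Hessians of
one mollification: `p_{ρ₁}[g] - p_{ρ₂}[g] = -∑ᵢⱼ ∂ᵢ∂ⱼ(gᵢⱼ ⋆ (Δ⁻¹ρ₁ - Δ⁻¹ρ₂))`. [folklore] -/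
theorem presApproxSlice_sub_eq {ρ₁ ρ₂ : UnitAddTorus d → ℝ} (hρ₁ : IsSmooth ρ₁) (hρ₂ : IsSmooth ρ₂)
    {g : d → d → UnitAddTorus d → ℝ} (hg : ∀ i j, Integrable (g i j) volume) (x : UnitAddTorus d) :
    presApproxSlice ρ₁ g x - presApproxSlice ρ₂ g x =
      -∑ i, ∑ j, partialDeriv i (partialDeriv j
        (g i j ⋆ fun y => invLaplacian ρ₁ y - invLaplacian ρ₂ y)) x := by
  have h1 := isSmooth_invLaplacian (F := ℝ) hρ₁
  have h2 := isSmooth_invLaplacian (F := ℝ) hρ₂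
  have hχ : IsSmooth (fun y => invLaplacian ρ₁ y - invLaplacian ρ₂ y) := h1.sub h2
  rw [presApproxSlice_eq_neg_sum hρ₁ hg, presApproxSlice_eq_neg_sum hρ₂ hg, neg_sub_neg, ← neg_sub,
    ← Finset.sum_sub_distrib]
  congr 1
  refine Finset.sum_congr rfl fun i _ => ?_
  rw [← Finset.sum_sub_distrib]
  refine Finset.sum_congr rfl fun j _ => ?_
  rw [partialDeriv_partialDeriv_convolution (hg i j) h1, partialDeriv_partialDeriv_convolution (hg i j) h2,
    partialDeriv_partialDeriv_convolution (hg i j) hχ,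
    ← convolution_sub_right_apply (hg i j) ((h1.partialDeriv j).partialDeriv i).continuous
      ((h2.partialDeriv j).partialDeriv i).continuous]
  congr 1
  funext y
  have e : partialDeriv j (fun y => invLaplacian ρ₁ y - invLaplacian ρ₂ y) =
      fun y => partialDeriv j (invLaplacian ρ₁) y - partialDeriv j (invLaplacian ρ₂) y :=
    funext (partialDeriv_fun_sub_apply (h1.isContDiff (by simp)) (h2.isContDiff (by simp)) j)
  rw [e, partialDeriv_fun_sub_apply ((h1.partialDeriv j).isContDiff (by simp))
    ((h2.partialDeriv j).isContDiff (by simp))]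

/-- The Laplacian of the mollification by `Δ⁻¹ρ₁ - Δ⁻¹ρ₂` for kernels of equal mass:
`Δ(g ⋆ (Δ⁻¹ρ₁ - Δ⁻¹ρ₂)) = g ⋆ ρ₁ - g ⋆ ρ₂` (`d` nonempty). [folklore] -/
theorem laplacian_convolution_invLaplacian_sub [Nonempty d] {ρ₁ ρ₂ : UnitAddTorus d → ℝ}
    (hρ₁ : IsSmooth ρ₁) (hρ₂ : IsSmooth ρ₂) (hmass : ∫ y, ρ₁ y = ∫ y, ρ₂ y)
    {θ : UnitAddTorus d → ℝ} (hθ : Integrable θ volume) (x : UnitAddTorus d) :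
    laplacian (θ ⋆ fun y => invLaplacian ρ₁ y - invLaplacian ρ₂ y) x = (θ ⋆ ρ₁) x - (θ ⋆ ρ₂) x := by
  have h1 := isSmooth_invLaplacian (F := ℝ) hρ₁
  have h2 := isSmooth_invLaplacian (F := ℝ) hρ₂
  have h12 : IsSmooth (fun y => invLaplacian ρ₁ y - invLaplacian ρ₂ y) := h1.sub h2
  rw [laplacian_convolution hθ h12]
  have e : laplacian (fun y => invLaplacian ρ₁ y - invLaplacian ρ₂ y) = fun y => ρ₁ y - ρ₂ y := by
    funext y
    rw [laplacian_fun_sub_apply h1 h2, laplacian_invLaplacian hρ₁, laplacian_invLaplacian hρ₂, hmass]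
    ring
  rw [e, convolution_sub_right_apply hθ hρ₁.continuous hρ₂.continuous]

omit [DecidableEq d] in
/-- The Laplacian of the mollification by `Δ⁻¹ρ`: `Δ(g ⋆ Δ⁻¹ρ) = g ⋆ ρ - (∫ρ)(∫g)` (`d` nonempty). [folklore] -/
theorem laplacian_convolution_invLaplacian [Nonempty d] {ρ : UnitAddTorus d → ℝ} (hρ : IsSmooth ρ)
    {θ : UnitAddTorus d → ℝ} (hθ : Integrable θ volume) (x : UnitAddTorus d) :
    laplacian (θ ⋆ invLaplacian ρ) x = (θ ⋆ ρ) x - (∫ y, ρ y) * ∫ y, θ y := by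
  rw [laplacian_convolution hθ (isSmooth_invLaplacian hρ)]
  have e : laplacian (invLaplacian ρ) = fun y => ρ y - ∫ z, ρ z := funext (laplacian_invLaplacian hρ)
  rw [e, convolution_sub_right_apply hθ hρ.continuous continuous_const, convolution_const_right_apply]

/-- **The Calderón–Zygmund step**: for a smooth kernel `χ` and integrable data,
`∫⁻ |∑ᵢⱼ ∂ᵢ∂ⱼ(gᵢⱼ ⋆ χ)|^r ≤ (n²)^{r-1} C^r ∑ᵢⱼ ∫⁻ |Δ(gᵢⱼ ⋆ χ)|^r`, `r = p.toReal` (the hypothesis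
`HessianBound` termwise, and convexity of `t ↦ t^r`). [folklore] -/
theorem lintegral_rpow_sum_hessian_convolution_le (hp1 : 1 ≤ p) (hpt : p ≠ ⊤) (hC : HessianBound d p C)
    {χ : UnitAddTorus d → ℝ} (hχ : IsSmooth χ) {g : d → d → UnitAddTorus d → ℝ}
    (hg : ∀ i j, Integrable (g i j) volume) :
    ∫⁻ x, ‖∑ i, ∑ j, partialDeriv i (partialDeriv j (g i j ⋆ χ)) x‖ₑ ^ p.toReal ≤
      ((Fintype.card d : ℝ≥0∞) ^ 2) ^ (p.toReal - 1) * (C : ℝ≥0∞) ^ p.toReal *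
        ∑ i, ∑ j, ∫⁻ x, ‖laplacian (g i j ⋆ χ) x‖ₑ ^ p.toReal := by
  have hp0 : p ≠ 0 := (zero_lt_one.trans_le hp1).ne'
  have hr1 : 1 ≤ p.toReal := by
    rw [← ENNReal.toReal_one]; exact (ENNReal.toReal_le_toReal ENNReal.one_ne_top hpt).2 hp1
  set H : d → d → UnitAddTorus d → ℝ := fun i j => partialDeriv i (partialDeriv j (g i j ⋆ χ)) with hH_def
  have hW : ∀ i j, IsSmooth (g i j ⋆ χ) := fun i j => isSmooth_convolution (hg i j) hχ
  have hH : ∀ i j, IsSmooth (H i j) := fun i j => ((hW i j).partialDeriv j).partialDeriv i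
  -- pointwise: `|∑ᵢⱼ Hᵢⱼ|^r ≤ (n²)^{r-1} ∑ᵢⱼ |Hᵢⱼ|^r`
  have hpt' : ∀ x, ‖∑ i, ∑ j, H i j x‖ₑ ^ p.toReal ≤
      ((Fintype.card d : ℝ≥0∞) ^ 2) ^ (p.toReal - 1) * ∑ i, ∑ j, ‖H i j x‖ₑ ^ p.toReal := by
    intro x
    calc ‖∑ i, ∑ j, H i j x‖ₑ ^ p.toReal ≤ (∑ i, ∑ j, ‖H i j x‖ₑ) ^ p.toReal := by
          gcongr
          exact (enorm_sum_le _ _).trans (Finset.sum_le_sum fun i _ => enorm_sum_le _ _)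
      _ ≤ _ := rpow_sum_sum_le (fun i j => ‖H i j x‖ₑ) hr1
  -- each Hessian is bounded by the CZ hypothesis
  have hCZ : ∀ i j, ∫⁻ x, ‖H i j x‖ₑ ^ p.toReal ≤
      (C : ℝ≥0∞) ^ p.toReal * ∫⁻ x, ‖laplacian (g i j ⋆ χ) x‖ₑ ^ p.toReal := fun i j =>
    lintegral_rpow_le_of_eLpNorm_le hp0 hpt (hC (g i j ⋆ χ) (hW i j) i j)
  calc ∫⁻ x, ‖∑ i, ∑ j, H i j x‖ₑ ^ p.toReal
      ≤ ∫⁻ x, ((Fintype.card d : ℝ≥0∞) ^ 2) ^ (p.toReal - 1) * ∑ i, ∑ j, ‖H i j x‖ₑ ^ p.toReal :=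
        lintegral_mono hpt'
    _ = ((Fintype.card d : ℝ≥0∞) ^ 2) ^ (p.toReal - 1) * ∑ i, ∑ j, ∫⁻ x, ‖H i j x‖ₑ ^ p.toReal := by
        have hm : ∀ i j, AEMeasurable (fun x => ‖H i j x‖ₑ ^ p.toReal) volume := fun i j =>
          ((hH i j).continuous.measurable.enorm.pow_const _).aemeasurable
        have e1 : ∫⁻ x, ∑ i, ∑ j, ‖H i j x‖ₑ ^ p.toReal = ∑ i, ∫⁻ x, ∑ j, ‖H i j x‖ₑ ^ p.toReal :=
          lintegral_finsetSum' _ fun i _ => Finset.aemeasurable_fun_sum _ fun j _ => hm i j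
        have e2 : ∀ i, ∫⁻ x, ∑ j, ‖H i j x‖ₑ ^ p.toReal = ∑ j, ∫⁻ x, ‖H i j x‖ₑ ^ p.toReal := fun i =>
          lintegral_finsetSum' _ fun j _ => hm i j
        rw [lintegral_const_mul' _ _ (ENNReal.rpow_ne_top_of_nonneg (by linarith) (by simp)), e1]
        simp_rw [e2]
    _ ≤ ((Fintype.card d : ℝ≥0∞) ^ 2) ^ (p.toReal - 1) * ∑ i, ∑ j,
          ((C : ℝ≥0∞) ^ p.toReal * ∫⁻ x, ‖laplacian (g i j ⋆ χ) x‖ₑ ^ p.toReal) := by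
        gcongr with i _ j _
        exact hCZ i j
    _ = _ := by
        rw [mul_assoc]
        congr 1
        rw [Finset.mul_sum]
        refine Finset.sum_congr rfl fun i _ => ?_
        rw [Finset.mul_sum]

/-- **Calderón–Zygmund bound for the difference of two approximate pressures** (slice form):
for smooth kernels `ρ₁`, `ρ₂` of equal mass and integrable data,
`∫⁻ |p_{ρ₁}[g] - p_{ρ₂}[g]|^r ≤ (n²)^{r-1} C^r ∑ᵢⱼ ∫⁻ |gᵢⱼ ⋆ ρ₁ - gᵢⱼ ⋆ ρ₂|^r`, `r = p.toReal`
(Robinson–Rodrigo–Sadowski 2016, Lemma 5.1, (5.10): `‖p‖_{L^r} ≤ C ∑ᵢⱼ ‖uᵢuⱼ‖_{L^r}`, applied to the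
difference of the mollified data). [cite: RobinsonRodrigoSadowskiCUP2016, Lemma 5.1 (5.10) (p. 88)] -/
theorem lintegral_rpow_presApproxSlice_sub_le [Nonempty d] (hp1 : 1 ≤ p) (hpt : p ≠ ⊤) (hC : HessianBound d p C)
    {ρ₁ ρ₂ : UnitAddTorus d → ℝ} (hρ₁ : IsSmooth ρ₁) (hρ₂ : IsSmooth ρ₂) (hmass : ∫ y, ρ₁ y = ∫ y, ρ₂ y)
    {g : d → d → UnitAddTorus d → ℝ} (hg : ∀ i j, Integrable (g i j) volume) :
    ∫⁻ x, ‖presApproxSlice ρ₁ g x - presApproxSlice ρ₂ g x‖ₑ ^ p.toReal ≤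
      ((Fintype.card d : ℝ≥0∞) ^ 2) ^ (p.toReal - 1) * (C : ℝ≥0∞) ^ p.toReal *
        ∑ i, ∑ j, ∫⁻ x, ‖(g i j ⋆ ρ₁) x - (g i j ⋆ ρ₂) x‖ₑ ^ p.toReal := by
  have hχ : IsSmooth (fun y => invLaplacian ρ₁ y - invLaplacian ρ₂ y) :=
    (isSmooth_invLaplacian hρ₁).sub (isSmooth_invLaplacian hρ₂)
  have h := lintegral_rpow_sum_hessian_convolution_le hp1 hpt hC hχ hg
  simp_rw [laplacian_convolution_invLaplacian_sub hρ₁ hρ₂ hmass (hg _ _)] at h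
  refine le_trans (le_of_eq ?_) h
  refine lintegral_congr fun x => ?_
  rw [presApproxSlice_sub_eq hρ₁ hρ₂ hg x, enorm_neg]

/-- **Calderón–Zygmund bound for the approximate pressure** (slice form): for a smooth
nonnegative kernel `ρ` of unit mass and data `gᵢⱼ ∈ L^p(T^d)`,
`∫⁻ |p_ρ[g]|^r ≤ (n²)^{r-1} C^r 2^{r-1} · 2 ∑ᵢⱼ ∫⁻ |gᵢⱼ|^r`, `r = p.toReal`
(`Δ(gᵢⱼ ⋆ Δ⁻¹ρ) = gᵢⱼ ⋆ ρ - ∫gᵢⱼ`, Young's inequality and Jensen; Robinson–Rodrigo–Sadowski 2016,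
Lemma 5.1, (5.10)). [cite: RobinsonRodrigoSadowskiCUP2016, Lemma 5.1 (5.10) (p. 88)] -/
theorem lintegral_rpow_presApproxSlice_le [Nonempty d] (hp1 : 1 ≤ p) (hpt : p ≠ ⊤) (hC : HessianBound d p C)
    {ρ : UnitAddTorus d → ℝ} (hρ : IsSmooth ρ) (hρ0 : ∀ y, 0 ≤ ρ y) (hρ1 : ∫ y, ρ y = 1)
    {g : d → d → UnitAddTorus d → ℝ} (hg : ∀ i j, MemLp (g i j) p volume) :
    ∫⁻ x, ‖presApproxSlice ρ g x‖ₑ ^ p.toReal ≤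
      ((Fintype.card d : ℝ≥0∞) ^ 2) ^ (p.toReal - 1) * (C : ℝ≥0∞) ^ p.toReal *
        ((2 : ℝ≥0∞) ^ (p.toReal - 1) * 2) * ∑ i, ∑ j, ∫⁻ x, ‖g i j x‖ₑ ^ p.toReal := by
  have hr1 : 1 ≤ p.toReal := by
    rw [← ENNReal.toReal_one]; exact (ENNReal.toReal_le_toReal ENNReal.one_ne_top hpt).2 hp1
  have hgi : ∀ i j, Integrable (g i j) volume := fun i j => (hg i j).integrable hp1
  have h := lintegral_rpow_sum_hessian_convolution_le hp1 hpt hC (isSmooth_invLaplacian hρ) hgi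
  simp_rw [laplacian_convolution_invLaplacian hρ (hgi _ _), hρ1, one_mul] at h
  have e0 : ∀ x, ‖presApproxSlice ρ g x‖ₑ ^ p.toReal =
      ‖∑ i, ∑ j, partialDeriv i (partialDeriv j (g i j ⋆ invLaplacian ρ)) x‖ₑ ^ p.toReal := fun x => by
    rw [presApproxSlice_eq_neg_sum hρ hgi x, enorm_neg]
  simp_rw [e0]
  refine h.trans ?_
  have hterm : ∀ i j, ∫⁻ x, ‖(g i j ⋆ ρ) x - ∫ y, g i j y‖ₑ ^ p.toReal ≤
      ((2 : ℝ≥0∞) ^ (p.toReal - 1) * 2) * ∫⁻ x, ‖g i j x‖ₑ ^ p.toReal := by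
    intro i j
    refine (lintegral_rpow_sub_const_le _ _ hr1).trans ?_
    rw [mul_assoc, two_mul]
    exact mul_le_mul_right (add_le_add (lintegral_rpow_enorm_convolution_le (hg i j).1 hρ.continuous hρ0 hρ1 hr1)
      (enorm_integral_rpow_le_lintegral (hg i j).1 hr1)) _
  calc _ ≤ ((Fintype.card d : ℝ≥0∞) ^ 2) ^ (p.toReal - 1) * (C : ℝ≥0∞) ^ p.toReal *
        ∑ i, ∑ j, (((2 : ℝ≥0∞) ^ (p.toReal - 1) * 2) * ∫⁻ x, ‖g i j x‖ₑ ^ p.toReal) := by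
        gcongr with i _ j _
        exact hterm i j
    _ = _ := by
        simp only [Finset.mul_sum]
        refine Finset.sum_congr rfl fun i _ => Finset.sum_congr rfl fun j _ => ?_
        ring

end SliceBounds

/-! ## Limits in `L^p`: completeness, pairings, a.e. products -/

section LimitTools

variable {α : Type*} [MeasurableSpace α] {μ : Measure α}

omit [Fintype d] [DecidableEq d] in
/-- **`L^p` is complete, function form**: a sequence of `L^p` functions whose pairwise distances
`‖fₙ - fₘ‖_{L^p}` tend to zero has an `L^p` limit (Mathlib's completeness of `Lp`, read back on
representatives). [folklore] -/
theorem exists_memLp_tendsto_of_tendsto_eLpNorm_sub {E : Type*} [NormedAddCommGroup E] [CompleteSpace E]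
    {p : ℝ≥0∞}
    (hp1 : 1 ≤ p) {f : ℕ → α → E} (hf : ∀ n, MemLp (f n) p μ)
    (hC : Tendsto (fun nm : ℕ × ℕ => eLpNorm (f nm.1 - f nm.2) p μ) atTop (𝓝 0)) :
    ∃ g : α → E, MemLp g p μ ∧ Tendsto (fun n => eLpNorm (f n - g) p μ) atTop (𝓝 0) := by
  haveI : Fact (1 ≤ p) := ⟨hp1⟩
  set F : ℕ → Lp E p μ := fun n => (hf n).toLp (f n) with hF
  have hFC : CauchySeq F := by
    rw [Lp.cauchySeq_Lp_iff_cauchySeq_eLpNorm]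
    refine (tendsto_congr fun nm => ?_).1 hC
    refine eLpNorm_congr_ae ?_
    filter_upwards [(hf nm.1).coeFn_toLp, (hf nm.2).coeFn_toLp] with x h1 h2
    simp only [Pi.sub_apply, hF, h1, h2]
  obtain ⟨G, hG⟩ := cauchySeq_tendsto_of_complete hFC
  refine ⟨G, Lp.memLp G, ?_⟩
  have h := (Lp.tendsto_Lp_iff_tendsto_eLpNorm' F G).1 hG
  refine (tendsto_congr fun n => ?_).1 h
  refine eLpNorm_congr_ae ?_
  filter_upwards [(hf n).coeFn_toLp] with x h1
  simp only [Pi.sub_apply, hF, h1]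

omit [Fintype d] [DecidableEq d] in
/-- From `‖fₙ - g‖_{L^p} → 0` to `∫⁻ ‖fₙ - g‖ₑ^{p.toReal} → 0` (`0 < p < ∞`). [folklore] -/
theorem tendsto_lintegral_rpow_of_tendsto_eLpNorm {E : Type*} [NormedAddCommGroup E] {p : ℝ≥0∞}
    (hp0 : p ≠ 0) (hpt : p ≠ ⊤) {ι : Type*} {l : Filter ι} {f : ι → α → E}
    (h : Tendsto (fun n => eLpNorm (f n) p μ) l (𝓝 0)) :
    Tendsto (fun n => ∫⁻ x, ‖f n x‖ₑ ^ p.toReal ∂μ) l (𝓝 0) := by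
  have hr : 0 < p.toReal := ENNReal.toReal_pos hp0 hpt
  have e : ∀ n, ∫⁻ x, ‖f n x‖ₑ ^ p.toReal ∂μ = (eLpNorm (f n) p μ) ^ p.toReal := fun n => by
    rw [eLpNorm_eq_lintegral_rpow_enorm_toReal hp0 hpt, one_div, ENNReal.rpow_inv_rpow hr.ne']
  simp_rw [e]
  have h2 := ((ENNReal.continuous_rpow_const (y := p.toReal)).tendsto (0 : ℝ≥0∞)).comp h
  rwa [ENNReal.zero_rpow_of_pos hr] at h2

omit [Fintype d] [DecidableEq d] in
/-- From `∫⁻ ‖fₙ‖ₑ^{p.toReal} → 0` to `‖fₙ‖_{L^p} → 0` (`0 < p < ∞`). [folklore] -/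
theorem tendsto_eLpNorm_of_tendsto_lintegral_rpow {E : Type*} [NormedAddCommGroup E] {p : ℝ≥0∞}
    (hp0 : p ≠ 0) (hpt : p ≠ ⊤) {ι : Type*} {l : Filter ι} {f : ι → α → E}
    (h : Tendsto (fun n => ∫⁻ x, ‖f n x‖ₑ ^ p.toReal ∂μ) l (𝓝 0)) :
    Tendsto (fun n => eLpNorm (f n) p μ) l (𝓝 0) := by
  have hr : 0 < p.toReal := ENNReal.toReal_pos hp0 hpt
  simp_rw [eLpNorm_eq_lintegral_rpow_enorm_toReal hp0 hpt]
  have h2 := ((ENNReal.continuous_rpow_const (y := 1 / p.toReal)).tendsto (0 : ℝ≥0∞)).comp h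
  rwa [ENNReal.zero_rpow_of_pos (by positivity : 0 < 1 / p.toReal)] at h2

omit [Fintype d] [DecidableEq d] in
/-- **Pairings converge along `L¹` convergence against a bounded weight**: if `gᵢ → g₀` in `L¹`
and `|f| ≤ M` a.e. (measurable), then `∫ f gᵢ → ∫ f g₀`. [folklore] -/
theorem tendsto_integral_mul_of_eLpNorm_one {ι : Type*} {l : Filter ι} {f : α → ℝ} {g : ι → α → ℝ}
    {g₀ : α → ℝ} {M : ℝ} (hfm : AEStronglyMeasurable f μ) (hfM : ∀ᵐ x ∂μ, ‖f x‖ ≤ M)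
    (hg : ∀ᶠ i in l, Integrable (g i) μ) (hg₀ : Integrable g₀ μ)
    (h : Tendsto (fun i => eLpNorm (fun x => g i x - g₀ x) 1 μ) l (𝓝 0)) :
    Tendsto (fun i => ∫ x, f x * g i x ∂μ) l (𝓝 (∫ x, f x * g₀ x ∂μ)) := by
  have hfg₀ : Integrable (fun x => f x * g₀ x) μ := hg₀.bdd_mul hfm hfM
  have hb : Tendsto (fun i => |M| * (eLpNorm (fun x => g i x - g₀ x) 1 μ).toReal) l (𝓝 0) := by
    have h2 := (ENNReal.tendsto_toReal ENNReal.zero_ne_top).comp h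
    rw [ENNReal.toReal_zero] at h2
    simpa using h2.const_mul |M|
  rw [tendsto_iff_norm_sub_tendsto_zero]
  refine squeeze_zero' (Eventually.of_forall fun i => norm_nonneg _) ?_ hb
  filter_upwards [hg, h.eventually (Iio_mem_nhds ENNReal.zero_lt_top)] with i hgi hi
  have hdi : Integrable (fun x => g i x - g₀ x) μ := hgi.sub hg₀
  have hfgi : Integrable (fun x => f x * g i x) μ := hgi.bdd_mul hfm hfM
  rw [← integral_sub hfgi hfg₀]
  have heq : (fun x => f x * g i x - f x * g₀ x) = fun x => f x * (g i x - g₀ x) := by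
    funext x; ring
  rw [heq]
  calc ‖∫ x, f x * (g i x - g₀ x) ∂μ‖ ≤ ∫ x, ‖f x * (g i x - g₀ x)‖ ∂μ := norm_integral_le_integral_norm _
    _ ≤ ∫ x, |M| * ‖g i x - g₀ x‖ ∂μ := by
        refine integral_mono_ae (hdi.bdd_mul hfm hfM).norm (hdi.norm.const_mul _) ?_
        filter_upwards [hfM] with x hx
        rw [norm_mul]
        exact mul_le_mul_of_nonneg_right (hx.trans (le_abs_self M)) (norm_nonneg _)
    _ = |M| * (eLpNorm (fun x => g i x - g₀ x) 1 μ).toReal := by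
        rw [integral_const_mul, integral_norm_eq_lintegral_enorm hdi.aestronglyMeasurable,
          eLpNorm_one_eq_lintegral_enorm]

omit [DecidableEq d] in
/-- **Pairings on the torus converge along `L^p` convergence**, `1 ≤ p`: if `gᵢ → g₀` in `L^p(T^d)`
(`gᵢ, g₀ ∈ L^p`) and `ψ` is continuous, then `∫ gᵢ ψ → ∫ g₀ ψ` (`‖·‖_{L¹} ≤ ‖·‖_{L^p}` on the
probability space `T^d`). [folklore] -/
theorem tendsto_integral_mul_of_tendsto_eLpNorm {ι : Type*} {l : Filter ι} {p : ℝ≥0∞} (hp1 : 1 ≤ p)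
    {g : ι → UnitAddTorus d → ℝ} {g₀ : UnitAddTorus d → ℝ} (hg : ∀ i, MemLp (g i) p volume)
    (hg₀ : MemLp g₀ p volume) (h : Tendsto (fun i => eLpNorm (fun x => g i x - g₀ x) p volume) l (𝓝 0))
    {ψ : UnitAddTorus d → ℝ} (hψ : Continuous ψ) :
    Tendsto (fun i => ∫ x, g i x * ψ x) l (𝓝 (∫ x, g₀ x * ψ x)) := by
  obtain ⟨M, hM⟩ := exists_forall_norm_le_of_continuous hψ
  have h1 : Tendsto (fun i => eLpNorm (fun x => g i x - g₀ x) 1 volume) l (𝓝 0) := by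
    refine tendsto_of_tendsto_of_tendsto_of_le_of_le tendsto_const_nhds h (fun i => zero_le) fun i => ?_
    exact eLpNorm_le_eLpNorm_of_exponent_le hp1 ((hg i).sub hg₀).1
  have key := tendsto_integral_mul_of_eLpNorm_one hψ.aestronglyMeasurable (Eventually.of_forall hM)
    (Eventually.of_forall fun i => (hg i).integrable hp1) (hg₀.integrable hp1) h1
  simp_rw [mul_comm (ψ _)] at key
  exact key

omit [Fintype d] [DecidableEq d] in
/-- An a.e. statement in the first variable holds a.e. for the product measure. [folklore] -/
theorem ae_prod_of_ae_fst {β : Type*} [MeasurableSpace β] {ν : Measure β} [SFinite ν]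
    {P : α → Prop} (h : ∀ᵐ a ∂μ, P a) : ∀ᵐ z ∂(μ.prod ν), P z.1 :=
  Measure.quasiMeasurePreserving_fst.ae h

omit [Fintype d] [DecidableEq d] in
/-- `MemLp` on the product from joint measurability and a finite `∫⁻ ‖·‖ₑ^r`. [folklore] -/
theorem memLp_of_lintegral_prod_lt_top {β : Type*} [MeasurableSpace β] {ν : Measure β} {p : ℝ≥0∞}
    (hp0 : p ≠ 0) (hpt : p ≠ ⊤) {f : α × β → ℝ} (hm : AEStronglyMeasurable f (μ.prod ν))
    (hf : ∫⁻ z, ‖f z‖ₑ ^ p.toReal ∂(μ.prod ν) < ⊤) : MemLp f p (μ.prod ν) := by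
  refine ⟨hm, ?_⟩
  rw [eLpNorm_eq_lintegral_rpow_enorm_toReal hp0 hpt]
  exact ENNReal.rpow_lt_top_of_nonneg (by positivity) hf.ne

omit [Fintype d] [DecidableEq d] in
/-- From `∫⁻ gₘ → 0`, a subsequence converges to `0` almost everywhere (choose `φ` with
`∫⁻ g_{φ k} ≤ 2^{-k}`; then `∑ₖ g_{φ k}` is a.e. finite). Same statement as the tree's
`Torus.exists_subseq_tendsto_ae_of_tendsto_lintegral` (`FluidPDE/DuchonRobertInviscidLimit`),
restated here to keep the import graph of this file inside `FunctionSpaces` + Mathlib. [folklore] -/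
theorem exists_strictMono_tendsto_ae_of_tendsto_lintegral {g : ℕ → α → ℝ≥0∞} (hg : ∀ m, AEMeasurable (g m) μ)
    (h : Tendsto (fun m => ∫⁻ a, g m a ∂μ) atTop (𝓝 0)) :
    ∃ φ : ℕ → ℕ, StrictMono φ ∧ ∀ᵐ a ∂μ, Tendsto (fun k => g (φ k) a) atTop (𝓝 0) := by
  have hev : ∀ k : ℕ, ∀ᶠ m in atTop, ∫⁻ a, g m a ∂μ ≤ (2⁻¹ : ℝ≥0∞) ^ k := fun k =>
    h.eventually (eventually_le_nhds (ENNReal.pow_pos (ENNReal.inv_pos.2 ENNReal.ofNat_ne_top) k))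
  obtain ⟨φ, hφ, hle⟩ := extraction_forall_of_eventually hev
  refine ⟨φ, hφ, ?_⟩
  have hsum : ∫⁻ a, ∑' k, g (φ k) a ∂μ ≠ (⊤ : ℝ≥0∞) := by
    rw [lintegral_tsum fun k => hg (φ k)]
    refine ne_top_of_le_ne_top ?_ (ENNReal.tsum_le_tsum hle)
    rw [ENNReal.tsum_geometric, ENNReal.one_sub_inv_two, inv_inv]
    exact ENNReal.ofNat_ne_top
  filter_upwards [ae_lt_top' (AEMeasurable.tsum fun k => hg (φ k)) hsum] with a ha
  exact ENNReal.tendsto_atTop_zero_of_tsum_ne_top ha.ne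

end LimitTools

/-! ## The approximate pressures of a time-dependent tensor and their `L^p` limit -/

section SpaceTime

variable {α : Type*} [MeasurableSpace α] {μ : Measure α} [SFinite μ]

/-- **The approximate pressures of a time-dependent tensor field** `G = (Gᵢⱼ(a, x))`:
slice-wise, `p_ρ[G](a) = p_ρ[G(a)] = ∑ᵢⱼ Gᵢⱼ(a) ⋆ κᵢⱼ[ρ]`. [folklore] -/
def presApprox (ρ : UnitAddTorus d → ℝ) (G : d → d → α → UnitAddTorus d → ℝ) (a : α) :
    UnitAddTorus d → ℝ :=
  presApproxSlice ρ fun i j => G i j a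

/-- **The canonical mollifier sequence** `ρₙ = Torus.kernel (1/(n+4))` (radius `≤ 1/4`, `→ 0`). [folklore] -/
def presMollifier (n : ℕ) : UnitAddTorus d → ℝ :=
  kernel (1 / ((n : ℝ) + 4))

omit [DecidableEq d] in
/-- The radii `1/(n+4)` of the canonical mollifiers are positive. [folklore] -/
theorem presMollifier_radius_pos (n : ℕ) : (0 : ℝ) < 1 / ((n : ℝ) + 4) := by positivity

omit [DecidableEq d] in
/-- The radii `1/(n+4)` of the canonical mollifiers are at most `1/4`. [folklore] -/
theorem presMollifier_radius_le (n : ℕ) : 1 / ((n : ℝ) + 4) ≤ (1 / 4 : ℝ) :=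
  one_div_le_one_div_of_le (by norm_num) (by linarith [n.cast_nonneg (α := ℝ)])

omit [DecidableEq d] in
/-- The canonical mollifiers are smooth. [folklore] -/
theorem isSmooth_presMollifier (n : ℕ) : IsSmooth (presMollifier (d := d) n) :=
  isSmooth_kernel (presMollifier_radius_pos n) (presMollifier_radius_le n)

omit [DecidableEq d] in
/-- The canonical mollifiers are nonnegative. [folklore] -/
theorem presMollifier_nonneg (n : ℕ) (y : UnitAddTorus d) : 0 ≤ presMollifier n y :=
  kernel_nonneg (presMollifier_radius_pos n).le y

omit [DecidableEq d] in
/-- The canonical mollifiers have unit mass. [folklore] -/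
theorem integral_presMollifier (n : ℕ) : ∫ y, presMollifier (d := d) n y = 1 :=
  integral_kernel (presMollifier_radius_pos n) (presMollifier_radius_le n)

omit [DecidableEq d] in
/-- The canonical mollifiers are eventually supported in every ball. [folklore] -/
theorem eventually_support_presMollifier_subset {δ : ℝ} (hδ : 0 < δ) :
    ∀ᶠ n : ℕ in atTop, support (presMollifier (d := d) n) ⊆ Metric.ball 0 δ := by
  have h4 : Tendsto (fun n : ℕ => ((n : ℝ) + 4)) atTop atTop :=
    tendsto_atTop_add_const_right _ _ tendsto_natCast_atTop_atTop
  have ht : Tendsto (fun n : ℕ => 1 / ((n : ℝ) + 4)) atTop (𝓝 0) := by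
    have := tendsto_inv_atTop_zero.comp h4
    simpa only [Function.comp_def, one_div] using this
  filter_upwards [ht.eventually (gt_mem_nhds hδ)] with n hn
  exact (support_kernel_subset (presMollifier_radius_pos n)).trans (Metric.ball_subset_ball hn.le)

omit [DecidableEq d] in
/-- The canonical mollifiers in the form consumed by `TorusApproximateIdentity`. [folklore] -/
theorem eventually_presMollifier :
    ∀ᶠ n : ℕ in atTop, (∀ y, 0 ≤ presMollifier (d := d) n y) ∧ ∫ y, presMollifier (d := d) n y = 1 ∧
      Continuous (presMollifier (d := d) n) :=
  Eventually.of_forall fun n => ⟨presMollifier_nonneg n, integral_presMollifier n,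
    (isSmooth_presMollifier n).continuous⟩

variable {p : ℝ≥0∞} {C : ℝ≥0}

/-- **The approximate pressures are jointly measurable** (parametrised convolutions with continuous
kernels, `Torus.aestronglyMeasurable_uncurry_convolution`). [folklore] -/
theorem aestronglyMeasurable_uncurry_presApprox {ρ : UnitAddTorus d → ℝ} (hρ : IsSmooth ρ)
    {G : d → d → α → UnitAddTorus d → ℝ}
    (hGm : ∀ i j, AEStronglyMeasurable (uncurry (G i j)) (μ.prod volume)) :
    AEStronglyMeasurable (uncurry (presApprox ρ G)) (μ.prod volume) := by
  have h : uncurry (presApprox ρ G) = fun z => ∑ i, ∑ j, (G i j z.1 ⋆ presKernel ρ i j) z.2 := by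
    funext z; rfl
  rw [h]
  refine Finset.aestronglyMeasurable_fun_sum _ fun i _ => Finset.aestronglyMeasurable_fun_sum _ fun j _ => ?_
  exact aestronglyMeasurable_uncurry_convolution (ContinuousLinearMap.lsmul ℝ ℝ) (hGm i j)
    (continuous_presKernel hρ i j)

end SpaceTime

/-! ## `L^p` bounds on the product space, the `L^p` limit, and the weak Poisson equation -/

section SpaceTimeLimit

variable {α : Type*} [MeasurableSpace α] {μ : Measure α} [SFinite μ] {p : ℝ≥0∞} {C : ℝ≥0}

/-- **The constant of the pressure bounds**: `K = (n²)^{r-1} C^r 2^{r-1} · 2`, `r = p.toReal`,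
`n = #d`, `C` the Calderón–Zygmund constant of `HessianBound d p C`. [folklore] -/
def presConst (d : Type*) [Fintype d] (p : ℝ≥0∞) (C : ℝ≥0) : ℝ≥0∞ :=
  ((Fintype.card d : ℝ≥0∞) ^ 2) ^ (p.toReal - 1) * (C : ℝ≥0∞) ^ p.toReal * ((2 : ℝ≥0∞) ^ (p.toReal - 1) * 2)

omit [DecidableEq d] in
/-- The constant of the pressure bounds is finite (`1 ≤ p`). [folklore] -/
theorem presConst_lt_top (hp1 : 1 ≤ p) (hpt : p ≠ ⊤) : presConst d p C < ⊤ := by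
  have hr1 : 1 ≤ p.toReal := by
    rw [← ENNReal.toReal_one]; exact (ENNReal.toReal_le_toReal ENNReal.one_ne_top hpt).2 hp1
  unfold presConst
  refine ENNReal.mul_lt_top (ENNReal.mul_lt_top ?_ ?_) (ENNReal.mul_lt_top ?_ ENNReal.ofNat_lt_top)
  · exact ENNReal.rpow_lt_top_of_nonneg (by linarith) (by simp)
  · exact ENNReal.rpow_lt_top_of_nonneg (by linarith) ENNReal.coe_ne_top
  · exact ENNReal.rpow_lt_top_of_nonneg (by linarith) ENNReal.ofNat_ne_top

omit [DecidableEq d] [SFinite μ] in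
/-- Slices of an `L^p` function on `α × T^d` are a.e. in `L^p(T^d)` (Tonelli). [folklore] -/
theorem ae_memLp_slice_of_lintegral (hp0 : p ≠ 0) (hpt : p ≠ ⊤) {Θ : α → UnitAddTorus d → ℝ}
    (hm : AEStronglyMeasurable (uncurry Θ) (μ.prod volume))
    (hf : ∫⁻ z, ‖Θ z.1 z.2‖ₑ ^ p.toReal ∂(μ.prod volume) < ⊤) : ∀ᵐ a ∂μ, MemLp (Θ a) p volume := by
  have h := ae_memLp_of_lintegral_prod_rpow_lt_top hm (ENNReal.toReal_pos hp0 hpt) hf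
  rwa [ENNReal.ofReal_toReal hpt] at h

omit [DecidableEq d] [SFinite μ] in
/-- Slices of an `L^p` tensor on `α × T^d` are a.e. in `L^p(T^d)`, all components at once. [folklore] -/
theorem ae_forall_memLp_slice (hp0 : p ≠ 0) (hpt : p ≠ ⊤) {G : d → d → α → UnitAddTorus d → ℝ}
    (hGm : ∀ i j, AEStronglyMeasurable (uncurry (G i j)) (μ.prod volume))
    (hGf : ∀ i j, ∫⁻ z, ‖G i j z.1 z.2‖ₑ ^ p.toReal ∂(μ.prod volume) < ⊤) :
    ∀ᵐ a ∂μ, ∀ i j, MemLp (G i j a) p volume :=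
  ae_all_iff.2 fun i => ae_all_iff.2 fun j => ae_memLp_slice_of_lintegral hp0 hpt (hGm i j) (hGf i j)

omit [DecidableEq d] in
/-- Mollified slices `(a, x) ↦ (Θ(a) ⋆ ρ)(x)` are jointly measurable (continuous kernel). [folklore] -/
theorem aestronglyMeasurable_uncurry_convolution_slice {Θ : α → UnitAddTorus d → ℝ}
    (hm : AEStronglyMeasurable (uncurry Θ) (μ.prod volume)) {ρ : UnitAddTorus d → ℝ} (hρ : Continuous ρ) :
    AEStronglyMeasurable (fun z : α × UnitAddTorus d => (Θ z.1 ⋆ ρ) z.2) (μ.prod volume) :=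
  aestronglyMeasurable_uncurry_convolution (ContinuousLinearMap.lsmul ℝ ℝ) hm hρ

/-- **`L^p` bound for the difference of two approximate pressures on the product space**
(Tonelli over the slice bound `lintegral_rpow_presApproxSlice_sub_le`). [cite: RobinsonRodrigoSadowskiCUP2016, Lemma 5.1 (5.10) (p. 88)] -/
theorem lintegral_prod_rpow_presApprox_sub_le [Nonempty d] (hp1 : 1 ≤ p) (hpt : p ≠ ⊤)
    (hC : HessianBound d p C) {ρ₁ ρ₂ : UnitAddTorus d → ℝ} (hρ₁ : IsSmooth ρ₁) (hρ₂ : IsSmooth ρ₂)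
    (hmass : ∫ y, ρ₁ y = ∫ y, ρ₂ y) {G : d → d → α → UnitAddTorus d → ℝ}
    (hGm : ∀ i j, AEStronglyMeasurable (uncurry (G i j)) (μ.prod volume))
    (hGf : ∀ i j, ∫⁻ z, ‖G i j z.1 z.2‖ₑ ^ p.toReal ∂(μ.prod volume) < ⊤) :
    ∫⁻ z, ‖presApprox ρ₁ G z.1 z.2 - presApprox ρ₂ G z.1 z.2‖ₑ ^ p.toReal ∂(μ.prod volume) ≤
      ((Fintype.card d : ℝ≥0∞) ^ 2) ^ (p.toReal - 1) * (C : ℝ≥0∞) ^ p.toReal *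
        ∑ i, ∑ j, ∫⁻ z, ‖(G i j z.1 ⋆ ρ₁) z.2 - (G i j z.1 ⋆ ρ₂) z.2‖ₑ ^ p.toReal ∂(μ.prod volume) := by
  have hp0 : p ≠ 0 := (zero_lt_one.trans_le hp1).ne'
  set A : ℝ≥0∞ := ((Fintype.card d : ℝ≥0∞) ^ 2) ^ (p.toReal - 1) * (C : ℝ≥0∞) ^ p.toReal with hA
  have hAt : A ≠ ⊤ := by
    have hr1 : 1 ≤ p.toReal := by
      rw [← ENNReal.toReal_one]; exact (ENNReal.toReal_le_toReal ENNReal.one_ne_top hpt).2 hp1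
    exact (ENNReal.mul_lt_top (ENNReal.rpow_lt_top_of_nonneg (by linarith) (by simp))
      (ENNReal.rpow_lt_top_of_nonneg (by linarith) ENNReal.coe_ne_top)).ne
  -- measurability
  have hPm : AEStronglyMeasurable (fun z : α × UnitAddTorus d =>
      presApprox ρ₁ G z.1 z.2 - presApprox ρ₂ G z.1 z.2) (μ.prod volume) :=
    (aestronglyMeasurable_uncurry_presApprox hρ₁ hGm).sub (aestronglyMeasurable_uncurry_presApprox hρ₂ hGm)
  have hDm : ∀ i j, AEStronglyMeasurable (fun z : α × UnitAddTorus d =>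
      (G i j z.1 ⋆ ρ₁) z.2 - (G i j z.1 ⋆ ρ₂) z.2) (μ.prod volume) := fun i j =>
    (aestronglyMeasurable_uncurry_convolution_slice (hGm i j) hρ₁.continuous).sub
      (aestronglyMeasurable_uncurry_convolution_slice (hGm i j) hρ₂.continuous)
  -- Tonelli on both sides
  rw [lintegral_prod _ (hPm.enorm.pow_const _)]
  have eR : ∀ i j, ∫⁻ z, ‖(G i j z.1 ⋆ ρ₁) z.2 - (G i j z.1 ⋆ ρ₂) z.2‖ₑ ^ p.toReal ∂(μ.prod volume) =
      ∫⁻ a, ∫⁻ x, ‖(G i j a ⋆ ρ₁) x - (G i j a ⋆ ρ₂) x‖ₑ ^ p.toReal ∂volume ∂μ := fun i j =>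
    lintegral_prod _ ((hDm i j).enorm.pow_const _)
  simp_rw [eR]
  -- the slice bound, a.e. in `a`
  have hslice : ∀ᵐ a ∂μ, ∫⁻ x, ‖presApprox ρ₁ G a x - presApprox ρ₂ G a x‖ₑ ^ p.toReal ∂volume ≤
      A * ∑ i, ∑ j, ∫⁻ x, ‖(G i j a ⋆ ρ₁) x - (G i j a ⋆ ρ₂) x‖ₑ ^ p.toReal ∂volume := by
    filter_upwards [ae_forall_memLp_slice hp0 hpt hGm hGf] with a ha
    exact lintegral_rpow_presApproxSlice_sub_le hp1 hpt hC hρ₁ hρ₂ hmass fun i j => (ha i j).integrable hp1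
  refine (lintegral_mono_ae hslice).trans (le_of_eq ?_)
  have hm : ∀ i j, AEMeasurable (fun a => ∫⁻ x, ‖(G i j a ⋆ ρ₁) x - (G i j a ⋆ ρ₂) x‖ₑ ^ p.toReal ∂volume) μ :=
    fun i j => ((hDm i j).enorm.pow_const _).lintegral_prod_right'
  rw [lintegral_const_mul'' _ (Finset.aemeasurable_fun_sum _ fun i _ =>
    Finset.aemeasurable_fun_sum _ fun j _ => hm i j)]
  congr 1
  rw [lintegral_finsetSum' _ fun i _ => Finset.aemeasurable_fun_sum _ fun j _ => hm i j]
  refine Finset.sum_congr rfl fun i _ => ?_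
  rw [lintegral_finsetSum' _ fun j _ => hm i j]

/-- **`L^p` bound for the approximate pressures on the product space**:
`∫⁻ |p_ρ[G]|^r ≤ K ∑ᵢⱼ ∫⁻ |Gᵢⱼ|^r` for a smooth nonnegative unit-mass kernel (Tonelli over
`lintegral_rpow_presApproxSlice_le`). [cite: RobinsonRodrigoSadowskiCUP2016, Lemma 5.1 (5.10) (p. 88)] -/
theorem lintegral_prod_rpow_presApprox_le [Nonempty d] (hp1 : 1 ≤ p) (hpt : p ≠ ⊤)
    (hC : HessianBound d p C) {ρ : UnitAddTorus d → ℝ} (hρ : IsSmooth ρ) (hρ0 : ∀ y, 0 ≤ ρ y)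
    (hρ1 : ∫ y, ρ y = 1) {G : d → d → α → UnitAddTorus d → ℝ}
    (hGm : ∀ i j, AEStronglyMeasurable (uncurry (G i j)) (μ.prod volume))
    (hGf : ∀ i j, ∫⁻ z, ‖G i j z.1 z.2‖ₑ ^ p.toReal ∂(μ.prod volume) < ⊤) :
    ∫⁻ z, ‖presApprox ρ G z.1 z.2‖ₑ ^ p.toReal ∂(μ.prod volume) ≤
      presConst d p C * ∑ i, ∑ j, ∫⁻ z, ‖G i j z.1 z.2‖ₑ ^ p.toReal ∂(μ.prod volume) := by
  have hp0 : p ≠ 0 := (zero_lt_one.trans_le hp1).ne'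
  have hPm : AEStronglyMeasurable (fun z : α × UnitAddTorus d => presApprox ρ G z.1 z.2) (μ.prod volume) :=
    aestronglyMeasurable_uncurry_presApprox hρ hGm
  rw [lintegral_prod _ (hPm.enorm.pow_const _)]
  have eR : ∀ i j, ∫⁻ z, ‖G i j z.1 z.2‖ₑ ^ p.toReal ∂(μ.prod volume) =
      ∫⁻ a, ∫⁻ x, ‖G i j a x‖ₑ ^ p.toReal ∂volume ∂μ := fun i j =>
    lintegral_prod _ ((hGm i j).enorm.pow_const _)
  simp_rw [eR]
  have hslice : ∀ᵐ a ∂μ, ∫⁻ x, ‖presApprox ρ G a x‖ₑ ^ p.toReal ∂volume ≤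
      presConst d p C * ∑ i, ∑ j, ∫⁻ x, ‖G i j a x‖ₑ ^ p.toReal ∂volume := by
    filter_upwards [ae_forall_memLp_slice hp0 hpt hGm hGf] with a ha
    exact lintegral_rpow_presApproxSlice_le hp1 hpt hC hρ hρ0 hρ1 ha
  refine (lintegral_mono_ae hslice).trans (le_of_eq ?_)
  have hm : ∀ i j, AEMeasurable (fun a => ∫⁻ x, ‖G i j a x‖ₑ ^ p.toReal ∂volume) μ :=
    fun i j => ((hGm i j).enorm.pow_const _).lintegral_prod_right'
  rw [lintegral_const_mul'' _ (Finset.aemeasurable_fun_sum _ fun i _ =>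
    Finset.aemeasurable_fun_sum _ fun j _ => hm i j)]
  congr 1
  rw [lintegral_finsetSum' _ fun i _ => Finset.aemeasurable_fun_sum _ fun j _ => hm i j]
  refine Finset.sum_congr rfl fun i _ => ?_
  rw [lintegral_finsetSum' _ fun j _ => hm i j]

/-- `|a - b|^r ≤ 2^{r-1} (|a - c|^r + |b - c|^r)` in `ℝ≥0∞`-norms, `r ≥ 1`. [folklore] -/
theorem enorm_sub_rpow_le_of_third (a b c : ℝ) {r : ℝ} (hr : 1 ≤ r) :
    ‖a - b‖ₑ ^ r ≤ (2 : ℝ≥0∞) ^ (r - 1) * (‖a - c‖ₑ ^ r + ‖b - c‖ₑ ^ r) := by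
  calc ‖a - b‖ₑ ^ r ≤ (‖a - c‖ₑ + ‖b - c‖ₑ) ^ r := by
        gcongr
        calc ‖a - b‖ₑ = ‖(a - c) + (c - b)‖ₑ := by congr 1; ring
          _ ≤ ‖a - c‖ₑ + ‖c - b‖ₑ := enorm_add_le _ _
          _ = ‖a - c‖ₑ + ‖b - c‖ₑ := by rw [enorm_sub_rev c b]
    _ ≤ _ := ENNReal.rpow_add_le_mul_rpow_add_rpow _ _ hr

omit [DecidableEq d] in
/-- **The mollified data are Cauchy in `L^p` of the product**: `∫⁻ |G ⋆ ρₙ - G ⋆ ρₘ|^r → 0` as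
`n, m → ∞` (`TorusApproximateIdentity.tendsto_lintegral_prod_rpow_enorm_convolution_sub_self`). [folklore] -/
theorem tendsto_lintegral_prod_convolution_sub_convolution (hp1 : 1 ≤ p) (hpt : p ≠ ⊤)
    {Θ : α → UnitAddTorus d → ℝ} (hm : AEStronglyMeasurable (uncurry Θ) (μ.prod volume))
    (hf : ∫⁻ z, ‖Θ z.1 z.2‖ₑ ^ p.toReal ∂(μ.prod volume) < ⊤) :
    Tendsto (fun nm : ℕ × ℕ => ∫⁻ z, ‖(Θ z.1 ⋆ presMollifier nm.1) z.2 - (Θ z.1 ⋆ presMollifier nm.2) z.2‖ₑ ^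
      p.toReal ∂(μ.prod volume)) atTop (𝓝 0) := by
  have hr1 : 1 ≤ p.toReal := by
    rw [← ENNReal.toReal_one]; exact (ENNReal.toReal_le_toReal ENNReal.one_ne_top hpt).2 hp1
  set F : ℕ → ℝ≥0∞ := fun n => ∫⁻ z, ‖(Θ z.1 ⋆ presMollifier n) z.2 - Θ z.1 z.2‖ₑ ^ p.toReal ∂(μ.prod volume)
    with hF
  have hF0 : Tendsto F atTop (𝓝 0) :=
    tendsto_lintegral_prod_rpow_enorm_convolution_sub_self eventually_presMollifier
      (fun δ hδ => eventually_support_presMollifier_subset hδ) hm hr1 hf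
  have hmeas : ∀ n, AEMeasurable (fun z : α × UnitAddTorus d =>
      ‖(Θ z.1 ⋆ presMollifier n) z.2 - Θ z.1 z.2‖ₑ ^ p.toReal) (μ.prod volume) := fun n =>
    ((aestronglyMeasurable_uncurry_convolution_slice hm (isSmooth_presMollifier n).continuous).sub
      hm).enorm.pow_const _
  have hbound : ∀ nm : ℕ × ℕ, ∫⁻ z, ‖(Θ z.1 ⋆ presMollifier nm.1) z.2 - (Θ z.1 ⋆ presMollifier nm.2) z.2‖ₑ ^
      p.toReal ∂(μ.prod volume) ≤ (2 : ℝ≥0∞) ^ (p.toReal - 1) * (F nm.1 + F nm.2) := by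
    intro nm
    calc _ ≤ ∫⁻ z, (2 : ℝ≥0∞) ^ (p.toReal - 1) * (‖(Θ z.1 ⋆ presMollifier nm.1) z.2 - Θ z.1 z.2‖ₑ ^ p.toReal +
          ‖(Θ z.1 ⋆ presMollifier nm.2) z.2 - Θ z.1 z.2‖ₑ ^ p.toReal) ∂(μ.prod volume) :=
          lintegral_mono fun z => enorm_sub_rpow_le_of_third _ _ _ hr1
      _ = _ := by
          rw [lintegral_const_mul' _ _ (ENNReal.rpow_ne_top_of_nonneg (by linarith) ENNReal.ofNat_ne_top),
            lintegral_add_left' (hmeas _)]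
  have hlim : Tendsto (fun nm : ℕ × ℕ => (2 : ℝ≥0∞) ^ (p.toReal - 1) * (F nm.1 + F nm.2)) atTop (𝓝 0) := by
    have h1 : Tendsto (fun nm : ℕ × ℕ => F nm.1) atTop (𝓝 0) := by
      rw [← prod_atTop_atTop_eq]; exact hF0.comp tendsto_fst
    have h2 : Tendsto (fun nm : ℕ × ℕ => F nm.2) atTop (𝓝 0) := by
      rw [← prod_atTop_atTop_eq]; exact hF0.comp tendsto_snd
    have h3 := ENNReal.Tendsto.const_mul (a := (2 : ℝ≥0∞) ^ (p.toReal - 1)) (h1.add h2)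
      (Or.inr (ENNReal.rpow_ne_top_of_nonneg (by linarith) ENNReal.ofNat_ne_top))
    simpa using h3
  exact tendsto_of_tendsto_of_tendsto_of_le_of_le tendsto_const_nhds hlim (fun _ => zero_le) hbound

end SpaceTimeLimit

/-! ## The pressure: existence of the `L^p` limit and the weak Poisson equation -/

section Pressure

variable {α : Type*} [MeasurableSpace α] {μ : Measure α} [SFinite μ] {p : ℝ≥0∞} {C : ℝ≥0}

omit [SFinite μ] in
/-- Linearity of the approximate pressure of a slice in the data (integrable slices). [folklore] -/
theorem presApproxSlice_sub {ρ : UnitAddTorus d → ℝ} (hρ : IsSmooth ρ) {g g' : d → d → UnitAddTorus d → ℝ}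
    (hg : ∀ i j, Integrable (g i j) volume) (hg' : ∀ i j, Integrable (g' i j) volume) (x : UnitAddTorus d) :
    presApproxSlice ρ (fun i j => g i j - g' i j) x = presApproxSlice ρ g x - presApproxSlice ρ g' x := by
  simp only [presApproxSlice, ← Finset.sum_sub_distrib]
  refine Finset.sum_congr rfl fun i _ => Finset.sum_congr rfl fun j _ => ?_
  exact convolution_sub_left_apply (hg i j) (hg' i j) (continuous_presKernel hρ i j) x

/-- **The pressure of an `L^p` tensor field on `α × T^d`** (`1 < p < ∞` through the
Calderón–Zygmund hypothesis `HessianBound d p C`): the approximate pressures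
`pₙ = p_{ρₙ}[G]` converge in `L^p(α × T^d)` to a jointly measurable `P` with
`∫⁻ |P|^r ≤ K ∑ᵢⱼ ∫⁻ |Gᵢⱼ|^r`, and for a.e. parameter `a` the slice `P(a)` is a very weak solution
of the pressure Poisson equation `ΔP(a) = -∂ᵢ∂ⱼGᵢⱼ(a)`:
`∫ P(a) Δφ = -∑ᵢⱼ ∫ Gᵢⱼ(a) ∂ᵢ∂ⱼφ` for every smooth `φ`
(Robinson–Rodrigo–Sadowski 2016, Lemma 5.1 with (5.7)/(5.10), and the identity
`⟨-Δp, ψ(t)⟩ = ⟨∂ᵢ∂ⱼ(uᵢuⱼ), ψ(t)⟩` "for almost every `t`" in the proof of Prop. 5.3;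
Duchon–Robert 2000, proof of Prop. 1: "the linear operator `uᵢuₖ → p` is strongly continuous on
`L^q`"). The `L^p` limit exists because `(pₙ)` is Cauchy
(`lintegral_prod_rpow_presApprox_sub_le` and the `L^p` approximate identity on the product);
the weak equation passes to the limit slice-wise along an a.e.-convergent subsequence. [cite: RobinsonRodrigoSadowskiCUP2016, Lemma 5.1 and Prop. 5.3 (pp. 88–90)] -/
theorem exists_pressure [Nonempty d] (hp1 : 1 ≤ p) (hpt : p ≠ ⊤) (hC : HessianBound d p C)
    {G : d → d → α → UnitAddTorus d → ℝ}
    (hGm : ∀ i j, AEStronglyMeasurable (uncurry (G i j)) (μ.prod volume))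
    (hGf : ∀ i j, ∫⁻ z, ‖G i j z.1 z.2‖ₑ ^ p.toReal ∂(μ.prod volume) < ⊤) :
    ∃ P : α → UnitAddTorus d → ℝ,
      AEStronglyMeasurable (uncurry P) (μ.prod volume) ∧
      ∫⁻ z, ‖P z.1 z.2‖ₑ ^ p.toReal ∂(μ.prod volume) ≤
        presConst d p C * ∑ i, ∑ j, ∫⁻ z, ‖G i j z.1 z.2‖ₑ ^ p.toReal ∂(μ.prod volume) ∧
      Tendsto (fun n => ∫⁻ z, ‖presApprox (presMollifier n) G z.1 z.2 - P z.1 z.2‖ₑ ^ p.toReal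
        ∂(μ.prod volume)) atTop (𝓝 0) ∧
      ∀ᵐ a ∂μ, ∀ φ : UnitAddTorus d → ℝ, IsSmooth φ →
        ∫ x, P a x * laplacian φ x = -∑ i, ∑ j, ∫ x, G i j a x * partialDeriv i (partialDeriv j φ) x := by
  have hp0 : p ≠ 0 := (zero_lt_one.trans_le hp1).ne'
  have hr : 0 < p.toReal := ENNReal.toReal_pos hp0 hpt
  set K : ℝ≥0∞ := presConst d p C with hK
  have hKt : K < ⊤ := presConst_lt_top hp1 hpt
  set S : ℝ≥0∞ := ∑ i, ∑ j, ∫⁻ z, ‖G i j z.1 z.2‖ₑ ^ p.toReal ∂(μ.prod volume) with hS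
  have hSt : S < ⊤ := by
    refine ENNReal.sum_lt_top.2 fun i _ => ENNReal.sum_lt_top.2 fun j _ => hGf i j
  -- the approximants as functions on the product
  set f : ℕ → α × UnitAddTorus d → ℝ := fun n z => presApprox (presMollifier n) G z.1 z.2 with hf_def
  have hfm : ∀ n, AEStronglyMeasurable (f n) (μ.prod volume) := fun n =>
    aestronglyMeasurable_uncurry_presApprox (isSmooth_presMollifier n) hGm
  have hfb : ∀ n, ∫⁻ z, ‖f n z‖ₑ ^ p.toReal ∂(μ.prod volume) ≤ K * S := fun n =>
    lintegral_prod_rpow_presApprox_le hp1 hpt hC (isSmooth_presMollifier n) (presMollifier_nonneg n)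
      (integral_presMollifier n) hGm hGf
  have hfp : ∀ n, MemLp (f n) p (μ.prod volume) := fun n =>
    memLp_of_lintegral_prod_lt_top hp0 hpt (hfm n) ((hfb n).trans_lt (ENNReal.mul_lt_top hKt hSt))
  -- Cauchy in `L^p`
  have hCauchy : Tendsto (fun nm : ℕ × ℕ => eLpNorm (f nm.1 - f nm.2) p (μ.prod volume)) atTop (𝓝 0) := by
    refine tendsto_eLpNorm_of_tendsto_lintegral_rpow hp0 hpt ?_
    set D : d → d → ℕ × ℕ → ℝ≥0∞ := fun i j nm => ∫⁻ z, ‖(G i j z.1 ⋆ presMollifier nm.1) z.2 -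
      (G i j z.1 ⋆ presMollifier nm.2) z.2‖ₑ ^ p.toReal ∂(μ.prod volume) with hD
    have hD0 : ∀ i j, Tendsto (D i j) atTop (𝓝 0) := fun i j =>
      tendsto_lintegral_prod_convolution_sub_convolution hp1 hpt (hGm i j) (hGf i j)
    set A : ℝ≥0∞ := ((Fintype.card d : ℝ≥0∞) ^ 2) ^ (p.toReal - 1) * (C : ℝ≥0∞) ^ p.toReal with hA
    have hAt : A ≠ ⊤ := by
      have hr1 : 1 ≤ p.toReal := by
        rw [← ENNReal.toReal_one]; exact (ENNReal.toReal_le_toReal ENNReal.one_ne_top hpt).2 hp1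
      exact (ENNReal.mul_lt_top (ENNReal.rpow_lt_top_of_nonneg (by linarith) (by simp))
        (ENNReal.rpow_lt_top_of_nonneg (by linarith) ENNReal.coe_ne_top)).ne
    have hbound : ∀ nm : ℕ × ℕ, ∫⁻ z, ‖(f nm.1 - f nm.2) z‖ₑ ^ p.toReal ∂(μ.prod volume) ≤
        A * ∑ i, ∑ j, D i j nm := fun nm =>
      lintegral_prod_rpow_presApprox_sub_le hp1 hpt hC (isSmooth_presMollifier nm.1)
        (isSmooth_presMollifier nm.2) (by rw [integral_presMollifier, integral_presMollifier]) hGm hGf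
    have hlim : Tendsto (fun nm : ℕ × ℕ => A * ∑ i, ∑ j, D i j nm) atTop (𝓝 0) := by
      have hs : Tendsto (fun nm : ℕ × ℕ => ∑ i, ∑ j, D i j nm) atTop (𝓝 0) := by
        have := tendsto_finsetSum (Finset.univ : Finset d) (a := fun _ => (0 : ℝ≥0∞)) (f := fun i nm => ∑ j, D i j nm)
          (x := (atTop : Filter (ℕ × ℕ))) fun i _ => by
            have := tendsto_finsetSum (Finset.univ : Finset d) (a := fun _ => (0 : ℝ≥0∞))
              (f := fun j nm => D i j nm) (x := (atTop : Filter (ℕ × ℕ))) fun j _ => hD0 i j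
            simpa using this
        simpa using this
      simpa using ENNReal.Tendsto.const_mul hs (Or.inr hAt)
    exact tendsto_of_tendsto_of_tendsto_of_le_of_le tendsto_const_nhds hlim (fun _ => zero_le) hbound
  -- the limit
  obtain ⟨Pu, hPu, hPlim⟩ := exists_memLp_tendsto_of_tendsto_eLpNorm_sub hp1 hfp hCauchy
  have hPlim' : Tendsto (fun n => ∫⁻ z, ‖f n z - Pu z‖ₑ ^ p.toReal ∂(μ.prod volume)) atTop (𝓝 0) :=
    tendsto_lintegral_rpow_of_tendsto_eLpNorm hp0 hpt hPlim
  refine ⟨fun a x => Pu (a, x), hPu.1, ?_, hPlim', ?_⟩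
  · -- the bound passes to the limit
    set B : ℝ≥0∞ := (K * S) ^ (1 / p.toReal) with hB
    have hfn : ∀ n, eLpNorm (f n) p (μ.prod volume) ≤ B := fun n => by
      rw [eLpNorm_eq_lintegral_rpow_enorm_toReal hp0 hpt, hB]
      exact ENNReal.rpow_le_rpow (hfb n) (by positivity)
    have hle : ∀ n, eLpNorm Pu p (μ.prod volume) ≤ eLpNorm (f n - Pu) p (μ.prod volume) + B := by
      intro n
      have e : Pu = (Pu - f n) + f n := by funext z; simp
      calc eLpNorm Pu p (μ.prod volume) = eLpNorm ((Pu - f n) + f n) p (μ.prod volume) := by rw [← e]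
        _ ≤ eLpNorm (Pu - f n) p (μ.prod volume) + eLpNorm (f n) p (μ.prod volume) :=
            eLpNorm_add_le (hPu.1.sub (hfm n)) (hfm n) hp1
        _ ≤ _ := by rw [eLpNorm_sub_comm]; exact add_le_add_right (hfn n) _
    have hlimB : Tendsto (fun n => eLpNorm (f n - Pu) p (μ.prod volume) + B) atTop (𝓝 (0 + B)) :=
      hPlim.add tendsto_const_nhds
    rw [zero_add] at hlimB
    have hP : eLpNorm Pu p (μ.prod volume) ≤ B := ge_of_tendsto' hlimB hle
    have h2 := ENNReal.rpow_le_rpow hP hr.le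
    rw [eLpNorm_eq_lintegral_rpow_enorm_toReal hp0 hpt, one_div, ENNReal.rpow_inv_rpow hr.ne', hB, one_div,
      ENNReal.rpow_inv_rpow hr.ne'] at h2
    exact h2
  · -- the weak Poisson equation, slice-wise a.e.
    -- (i) an a.e.-convergent subsequence of slices
    set g : ℕ → α → ℝ≥0∞ := fun n a => ∫⁻ x, ‖f n (a, x) - Pu (a, x)‖ₑ ^ p.toReal ∂volume with hg
    have hgm : ∀ n, AEMeasurable (g n) μ := fun n =>
      (((hfm n).sub hPu.1).enorm.pow_const _).lintegral_prod_right'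
    have hg0 : Tendsto (fun n => ∫⁻ a, g n a ∂μ) atTop (𝓝 0) := by
      refine (tendsto_congr fun n => ?_).1 hPlim'
      exact lintegral_prod _ (((hfm n).sub hPu.1).enorm.pow_const _)
    obtain ⟨ns, hns, hae⟩ := exists_strictMono_tendsto_ae_of_tendsto_lintegral hgm hg0
    -- (ii) slices of the data and of the limit are a.e. in `L^p`
    have hPuf : ∫⁻ z, ‖Pu z‖ₑ ^ p.toReal ∂(μ.prod volume) < ⊤ :=
      lintegral_rpow_enorm_lt_top_of_eLpNorm_lt_top hp0 hpt hPu.2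
    have hPslice : ∀ᵐ a ∂μ, MemLp (fun x => Pu (a, x)) p volume :=
      ae_memLp_slice_of_lintegral hp0 hpt (Θ := fun a x => Pu (a, x)) hPu.1 hPuf
    filter_upwards [hae, ae_forall_memLp_slice hp0 hpt hGm hGf, hPslice] with a ha hGa hPa φ hφ
    have hGi : ∀ i j, Integrable (G i j a) volume := fun i j => (hGa i j).integrable hp1
    -- the identity for the approximants
    have hid : ∀ k, ∫ x, f (ns k) (a, x) * laplacian φ x =
        -∑ i, ∑ j, ∫ x, (G i j a ⋆ presMollifier (ns k)) x * partialDeriv i (partialDeriv j φ) x := fun k =>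
      integral_presApproxSlice_mul_laplacian (isSmooth_presMollifier (ns k)) hGi hφ
    -- left-hand sides converge
    have hL : Tendsto (fun k => ∫ x, f (ns k) (a, x) * laplacian φ x) atTop (𝓝 (∫ x, Pu (a, x) * laplacian φ x)) := by
      refine tendsto_integral_mul_of_tendsto_eLpNorm hp1 (g := fun k x => f (ns k) (a, x)) (fun k => ?_) hPa ?_
        hφ.laplacian.continuous
      · exact (continuous_presApproxSlice (isSmooth_presMollifier (ns k)) hGi).memLp_of_hasCompactSupport
          (HasCompactSupport.of_compactSpace _)
      · exact tendsto_eLpNorm_of_tendsto_lintegral_rpow hp0 hpt ha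
    -- right-hand sides converge
    have hR : Tendsto (fun k => -∑ i, ∑ j, ∫ x, (G i j a ⋆ presMollifier (ns k)) x * partialDeriv i (partialDeriv j φ) x)
        atTop (𝓝 (-∑ i, ∑ j, ∫ x, G i j a x * partialDeriv i (partialDeriv j φ) x)) := by
      refine Tendsto.neg (tendsto_finsetSum _ fun i _ => tendsto_finsetSum _ fun j _ => ?_)
      have hconv : Tendsto (fun k => eLpNorm (fun x => (G i j a ⋆ presMollifier (ns k)) x - G i j a x) p volume)
          atTop (𝓝 0) := by
        have h := tendsto_eLpNorm_convolution_sub_self_of_eventually eventually_presMollifier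
          (fun δ hδ => eventually_support_presMollifier_subset hδ) hp1 hpt (hGa i j)
        exact h.comp hns.tendsto_atTop
      refine tendsto_integral_mul_of_tendsto_eLpNorm hp1 (g := fun k x => (G i j a ⋆ presMollifier (ns k)) x)
        (fun k => ?_) (hGa i j) hconv ((hφ.partialDeriv j).partialDeriv i).continuous
      exact (continuous_convolution (hGi i j) (isSmooth_presMollifier (ns k)).continuous).memLp_of_hasCompactSupport
        (HasCompactSupport.of_compactSpace _)
    have hL' : Tendsto (fun k => ∫ x, f (ns k) (a, x) * laplacian φ x) atTop
        (𝓝 (-∑ i, ∑ j, ∫ x, G i j a x * partialDeriv i (partialDeriv j φ) x)) :=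
      (tendsto_congr hid).2 hR
    exact tendsto_nhds_unique hL hL'

/-- **Continuity of the pressure in the data** (Duchon–Robert 2000, proof of Prop. 1: "the
linear operator `uᵢuₖ → p` is strongly continuous on `L^q`"; Robinson–Rodrigo–Sadowski 2016,
(5.10)): if `P`, `P'` are `L^p` limits of the approximate pressures of `G`, `G'`, then
`∫⁻ |P - P'|^r ≤ K ∑ᵢⱼ ∫⁻ |Gᵢⱼ - G'ᵢⱼ|^r` (the approximate pressures are linear in the data, and
the bound `lintegral_prod_rpow_presApprox_le` passes to the limit). [cite: RobinsonRodrigoSadowskiCUP2016, Lemma 5.1 (5.10) (p. 88)] -/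
theorem lintegral_prod_rpow_pressure_sub_le [Nonempty d] (hp1 : 1 ≤ p) (hpt : p ≠ ⊤)
    (hC : HessianBound d p C) {G G' : d → d → α → UnitAddTorus d → ℝ}
    (hGm : ∀ i j, AEStronglyMeasurable (uncurry (G i j)) (μ.prod volume))
    (hGf : ∀ i j, ∫⁻ z, ‖G i j z.1 z.2‖ₑ ^ p.toReal ∂(μ.prod volume) < ⊤)
    (hG'm : ∀ i j, AEStronglyMeasurable (uncurry (G' i j)) (μ.prod volume))
    (hG'f : ∀ i j, ∫⁻ z, ‖G' i j z.1 z.2‖ₑ ^ p.toReal ∂(μ.prod volume) < ⊤)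
    {P P' : α → UnitAddTorus d → ℝ} (hPm : AEStronglyMeasurable (uncurry P) (μ.prod volume))
    (hP'm : AEStronglyMeasurable (uncurry P') (μ.prod volume))
    (hP : Tendsto (fun n => ∫⁻ z, ‖presApprox (presMollifier n) G z.1 z.2 - P z.1 z.2‖ₑ ^ p.toReal
      ∂(μ.prod volume)) atTop (𝓝 0))
    (hP' : Tendsto (fun n => ∫⁻ z, ‖presApprox (presMollifier n) G' z.1 z.2 - P' z.1 z.2‖ₑ ^ p.toReal
      ∂(μ.prod volume)) atTop (𝓝 0)) :
    ∫⁻ z, ‖P z.1 z.2 - P' z.1 z.2‖ₑ ^ p.toReal ∂(μ.prod volume) ≤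
      presConst d p C * ∑ i, ∑ j, ∫⁻ z, ‖G i j z.1 z.2 - G' i j z.1 z.2‖ₑ ^ p.toReal ∂(μ.prod volume) := by
  have hp0 : p ≠ 0 := (zero_lt_one.trans_le hp1).ne'
  have hr : 0 < p.toReal := ENNReal.toReal_pos hp0 hpt
  have hr1 : 1 ≤ p.toReal := by
    rw [← ENNReal.toReal_one]; exact (ENNReal.toReal_le_toReal ENNReal.one_ne_top hpt).2 hp1
  -- the difference data
  set H : d → d → α → UnitAddTorus d → ℝ := fun i j a x => G i j a x - G' i j a x with hH
  have hHm : ∀ i j, AEStronglyMeasurable (uncurry (H i j)) (μ.prod volume) := fun i j =>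
    (hGm i j).sub (hG'm i j)
  have hHf : ∀ i j, ∫⁻ z, ‖H i j z.1 z.2‖ₑ ^ p.toReal ∂(μ.prod volume) < ⊤ := by
    intro i j
    calc ∫⁻ z, ‖H i j z.1 z.2‖ₑ ^ p.toReal ∂(μ.prod volume)
        ≤ ∫⁻ z, (2 : ℝ≥0∞) ^ (p.toReal - 1) * (‖G i j z.1 z.2 - 0‖ₑ ^ p.toReal + ‖G' i j z.1 z.2 - 0‖ₑ ^ p.toReal)
            ∂(μ.prod volume) := lintegral_mono fun z => enorm_sub_rpow_le_of_third _ _ 0 hr1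
      _ < ⊤ := by
          simp only [sub_zero]
          have hm1 : AEMeasurable (fun z : α × UnitAddTorus d => ‖G i j z.1 z.2‖ₑ ^ p.toReal) (μ.prod volume) :=
            (hGm i j).enorm.pow_const _
          rw [lintegral_const_mul' _ _ (ENNReal.rpow_ne_top_of_nonneg (by linarith) ENNReal.ofNat_ne_top),
            lintegral_add_left' hm1]
          exact ENNReal.mul_lt_top (ENNReal.rpow_lt_top_of_nonneg (by linarith) ENNReal.ofNat_ne_top)
            (ENNReal.add_lt_top.2 ⟨hGf i j, hG'f i j⟩)
  set f : ℕ → α × UnitAddTorus d → ℝ := fun n z => presApprox (presMollifier n) G z.1 z.2 with hf_def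
  set f' : ℕ → α × UnitAddTorus d → ℝ := fun n z => presApprox (presMollifier n) G' z.1 z.2 with hf'_def
  set h : ℕ → α × UnitAddTorus d → ℝ := fun n z => presApprox (presMollifier n) H z.1 z.2 with hh_def
  have hfm : ∀ n, AEStronglyMeasurable (f n) (μ.prod volume) := fun n =>
    aestronglyMeasurable_uncurry_presApprox (isSmooth_presMollifier n) hGm
  have hf'm : ∀ n, AEStronglyMeasurable (f' n) (μ.prod volume) := fun n =>
    aestronglyMeasurable_uncurry_presApprox (isSmooth_presMollifier n) hG'm
  -- linearity a.e.
  have hlin : ∀ n, f n - f' n =ᵐ[μ.prod volume] h n := by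
    intro n
    have hae : ∀ᵐ a ∂μ, ∀ x, f n (a, x) - f' n (a, x) = h n (a, x) := by
      filter_upwards [ae_forall_memLp_slice hp0 hpt hGm hGf, ae_forall_memLp_slice hp0 hpt hG'm hG'f]
        with a ha ha' x
      simp only [hf_def, hf'_def, hh_def, presApprox]
      rw [← presApproxSlice_sub (isSmooth_presMollifier n) (fun i j => (ha i j).integrable hp1)
        (fun i j => (ha' i j).integrable hp1)]
      rfl
    filter_upwards [ae_prod_of_ae_fst (ν := (volume : Measure (UnitAddTorus d))) hae] with z hz
    exact hz z.2
  -- the bound for `h n`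
  set S : ℝ≥0∞ := ∑ i, ∑ j, ∫⁻ z, ‖H i j z.1 z.2‖ₑ ^ p.toReal ∂(μ.prod volume) with hS
  set B : ℝ≥0∞ := (presConst d p C * S) ^ (1 / p.toReal) with hB
  have hhn : ∀ n, eLpNorm (f n - f' n) p (μ.prod volume) ≤ B := fun n => by
    rw [eLpNorm_congr_ae (hlin n), eLpNorm_eq_lintegral_rpow_enorm_toReal hp0 hpt, hB]
    exact ENNReal.rpow_le_rpow (lintegral_prod_rpow_presApprox_le hp1 hpt hC (isSmooth_presMollifier n)
      (presMollifier_nonneg n) (integral_presMollifier n) hHm hHf) (by positivity)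
  -- triangle inequality and passage to the limit
  set Pu : α × UnitAddTorus d → ℝ := uncurry P with hPu
  set Pu' : α × UnitAddTorus d → ℝ := uncurry P' with hPu'
  have e1 : Tendsto (fun n => eLpNorm (Pu - f n) p (μ.prod volume)) atTop (𝓝 0) := by
    have := tendsto_eLpNorm_of_tendsto_lintegral_rpow hp0 hpt (f := fun n z => f n z - Pu z) hP
    refine (tendsto_congr fun n => ?_).1 this
    rw [← eLpNorm_sub_comm]; rfl
  have e3 : Tendsto (fun n => eLpNorm (f' n - Pu') p (μ.prod volume)) atTop (𝓝 0) :=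
    tendsto_eLpNorm_of_tendsto_lintegral_rpow hp0 hpt (f := fun n z => f' n z - Pu' z) hP'
  have hle : ∀ n, eLpNorm (Pu - Pu') p (μ.prod volume) ≤
      eLpNorm (Pu - f n) p (μ.prod volume) + (B + eLpNorm (f' n - Pu') p (μ.prod volume)) := by
    intro n
    have e : Pu - Pu' = (Pu - f n) + ((f n - f' n) + (f' n - Pu')) := by funext z; simp
    calc eLpNorm (Pu - Pu') p (μ.prod volume)
        ≤ eLpNorm (Pu - f n) p (μ.prod volume) + eLpNorm ((f n - f' n) + (f' n - Pu')) p (μ.prod volume) := by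
          rw [e]; exact eLpNorm_add_le (hPm.sub (hfm n)) (((hfm n).sub (hf'm n)).add ((hf'm n).sub hP'm)) hp1
      _ ≤ eLpNorm (Pu - f n) p (μ.prod volume) +
          (eLpNorm (f n - f' n) p (μ.prod volume) + eLpNorm (f' n - Pu') p (μ.prod volume)) :=
          add_le_add_right (eLpNorm_add_le ((hfm n).sub (hf'm n)) ((hf'm n).sub hP'm) hp1) _
      _ ≤ _ := add_le_add_right (add_le_add_left (hhn n) _) _
  have hlim : Tendsto (fun n => eLpNorm (Pu - f n) p (μ.prod volume) + (B + eLpNorm (f' n - Pu') p (μ.prod volume)))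
      atTop (𝓝 (0 + (B + 0))) := e1.add (tendsto_const_nhds.add e3)
  rw [zero_add, add_zero] at hlim
  have hPP : eLpNorm (Pu - Pu') p (μ.prod volume) ≤ B := ge_of_tendsto' hlim hle
  have h2 := ENNReal.rpow_le_rpow hPP hr.le
  rw [eLpNorm_eq_lintegral_rpow_enorm_toReal hp0 hpt, one_div, ENNReal.rpow_inv_rpow hr.ne', hB, one_div,
    ENNReal.rpow_inv_rpow hr.ne'] at h2
  exact h2

end Pressure

end Literature.Analysis.FluidPDE.Torus
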